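import Summits.QuantumFields.YangMills.Theses.MirrorModularBoosts
import Summits.QuantumFields.YangMills.Theorems.LatticeGapOnTrajectory.Negative.ZeroCouplingGap
import Literature.MathematicalPhysics.QuantumLattice.GaugeGroupsProofs

/-!
# Disproof of `CurvatureBoostCovariance` (crux `stmt-QuantumFields-9663`) — findings

Standing adversary (cdisprove, generation 2) on the ENGINE of route MirrorModularBoosts:
`W₁ r sch S₁ → (RP in the eight planar frames) → (planar spectral cone) → (planar-rotation
invariance of every S₁ n on ⁰𝒮)`, for every compact simple `G`.  VERDICT SO FAR: **no kill; the
crux is unfalsifiable short of an anisotropic gapped Wilson continuum limit of `tr F²`** (the open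
problem itself), while its model-blind core is FALSE.  Everything below is checked Lean (rc 0);
the only `sorry` is the documented near-miss §1b.  Prose lives in docstrings.

## Index
* §0 `crux_iff` — the crux unbundled into `W1 ∧ EightFrameRP ∧ PlanarCone → PlanarInvariant`
  (definitional); `CurvatureBoostCovarianceOnAllTests` (the natural strengthening).
* §1 `ModelBlind`, `curvatureBoostCovariance_of_modelBlind` (PROVED: core ⇒ crux) and
  `curvatureBoostCovariance_false_without_hconv : ¬ ModelBlind` (NEAR-MISS, `sorry`; the paper
  witness — the `W(B₄)`-symmetric generalised free field `Ĉ = (1+ε e₂(p_μ²)²)/(p²+m²)`, RP in all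
  16 mirrors, coned, gapped, anisotropic on ⁰𝒮 by the factor `1 + ε m⁸/16` between the axis and
  the planar diagonal — is written out and verified in the docstring, with the reasons it is not
  formalised and why no cheaper witness exists).  CONSEQUENCE FOR PROVERS: the intended modular
  proof (Borchers/BGL/BDFS) is model-blind, hence cannot work as stated; the lattice tie must be
  USED, i.e. a YM-specific input (UV dimension of `tr F² < 5`, cards anisotropy-costs-a-dimension /
  one-field-cocycle-pinning / boosts-inherit-mirrors) is mandatory.
* §2 `tie_unique` (the tie pins `S₁` on off-diagonal real tensors: a counterexample IS an
  anisotropic Wilson limit), `latticeSchwinger_eq_zero_of_c_eq_zero`, `tie_apply_eq_zero_of_c_eq_zero`,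
  `apply_linActMulti_eq_of_c_eq_zero` (every `c ≡ 0` scheme collapses: the tied family vanishes
  on ⁰𝒮-tensors and is invariant there under EVERY isometry — no E2, no cone needed).
* §3 NON-VACUITY for every `G`, `r`: (imported, landed) `hasLatticeMassGap_of_zero_coupling` (any scheme
  with `β ≡ 0` has the uniform lattice gap for every `Δ`),
  `hypotheses_vac` (zero scheme + vacuum satisfy `W1 ∧ EightFrameRP ∧ PlanarCone ∧ PlanarInvariant`).
  `W₁` carries NO non-triviality: the crux is contentful only on limits HypercubicLimit supplies.
* §4 STRENGTHENING REFUTED (sorry-free, axioms standard): `not_curvatureBoostCovarianceOnAllTests`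
  — dropping `IsOffDiagonal F →` from the conclusion makes the crux FALSE (`S♯` = vacuum +
  evaluation at `(e₁,e₁,e₁)` in degree 3 satisfies every hypothesis for `SU(2)`, zero scheme —
  `hypotheses_sharp` — and the half-turn `diag(-1,-1,1,1)` flips it).  Never state invariance as
  equality of functionals on `𝓢`; nothing pins a tied family at coincident points.
* §6 THE `β ≡ 0` COLLAPSE IN LEAN (sorry-free, ~750 lines): `integral_pi_eq_integral_update`
  (resampling one coordinate of a product probability), `integral_centred_private_eq_zero`,
  `exists_torusMinimal` (private link on the torus), `integral_prod_cobs_eq_zero`,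
  `integral_prod_actionDensity_sub` (= `(6d₀ − m)ⁿ`), `latticeSchwinger_beta_zero` (EXACT formula
  for every `c_k, m_k, a_k, L_k`, every faithful `ρ`), `tie_beta_zero_factorises` (a family tied to a
  scheme with `β_k = 0` FREQUENTLY is a c-number field on off-diagonal real tensors — in particular
  never `IsNontrivial`; so any counterexample / any non-trivial witness has `β_k ≠ 0` for ALL large
  `k`), `apply_linActMulti_eq_of_beta_zero` (the crux's conclusion for EVERY isometry reduces to the
  one-point distribution).
* §7 (docstring `stubs_preassessed`) refuter's pre-assessment of the three cards' first-lemma stubs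
  (none false; `OddTopHarmonicVanishes` provable without its top-harmonic/continuity hypotheses).
* §5 (docstring `regimes_tried`) the attack ledger: β ≡ 0 with arbitrary `(c,m,a,L,ρ)` ⇒ EXACT
  c-number field on ⁰𝒮-tensors (§6); small `|β_k|`
  (Osterwalder–Seiler region) ⇒ c-number field again (paper); classical / sheet / finite-order
  junk for the model-blind core ⇒ each fails multi-frame RP.  THE WALL: a counterexample needs
  `β_k` to leave the convergent strong-coupling region along a scheme with a non-Gaussian-free
  anisotropic limit — control of 4D non-abelian LGT at intermediate/weak coupling.

LANDED (importable) negative-side support files, `Summits/QuantumFields/YangMills/Theorems/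
CurvatureBoostCovariance/Negative/`: `Unbundled.lean` (§0–§2: crux_iff, ModelBlind,
of_modelBlind, tie_unique, c ≡ 0 collapse; p70469), `VacuumSharp.lean` (§3–§4a: vac, sharp,
hypotheses_vac, hypotheses_sharp; p71280), `OnAllTestsFalse.lean` (§4b:
not_curvatureBoostCovarianceOnAllTests; p71512), `BetaZeroResample.lean`, `BetaZeroMoments.lean`,
`BetaZeroTie.lean` (§6: the β ≡ 0 collapse; p71235, p71497, p71676).  Ideators / planners / the
lead may `import` them (namespace `Summit.QuantumFields.YangMills.Theorems.CurvatureBoostCovariance.Negative`).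

History: generation-1 seat (refuter-cdisprove-stmt-QuantumFields-9663-0) attached a 1773-line
Disproof.lean as item evidence (sha256 7c063fde567a279b; §6 there = the β≡0 collapse in Lean:
`latticeSchwinger_beta_zero`, `tie_beta_zero_factorises`, `planar_on_tensors_of_beta_zero`); that
file is not readable from later seats' jails and was never published to the crux directory —
this file re-establishes the findings in the tree and extends §4 (degree-3 witness, no sign
analysis) and §5.
-/

noncomputable section

open scoped SchwartzMap ComplexConjugate
open MeasureTheory Filter Topology Complex ProbabilityTheory
open Literature.MathematicalPhysics.AQFT Literature.MathematicalPhysics.QuantumLattice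
open Literature.MathematicalPhysics.QuantumFieldTheory
open Literature.Probability.LatticeModels (Torus.proj box)

namespace Summit.QuantumFields.YangMills.Cruxes.CurvatureBoostCovariance.Disproof

local notation "E4" => EuclideanSpace ℝ (Fin 4)

/-! ## §0 The crux unbundled -/

/-- OS clauses E0 (normalisation, hermiticity), E0', E2 (along `e₀`), E3, E4 of the one-species family. -/
def OSPackage (S₁ : SchwingerFamily E4) : Prop :=
  S₁.toLabelled.IsNormalized ∧ S₁.toLabelled.IsHermitian ∧ S₁.toLabelled.HasLinearGrowth ∧
    S₁.toLabelled.IsReflectionPositive ∧ S₁.toLabelled.IsSymmetric ∧ S₁.toLabelled.HasClusterProperty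

/-- Translation invariance on `⁰𝒮`. -/
def Translations (S₁ : SchwingerFamily E4) : Prop :=
  ∀ (n : ℕ) (a : E4) (F : 𝓢((Fin n → E4), ℂ)), IsOffDiagonal F → S₁ n (translateMulti a F) = S₁ n F

/-- Invariance on `⁰𝒮` under the proper signed permutations `W(B₄) ∩ SO(4)`. -/
def Hypercubic (S₁ : SchwingerFamily E4) : Prop :=
  ∀ (R : E4 ≃ₗᵢ[ℝ] E4), LinearMap.det (R.toLinearEquiv : E4 →ₗ[ℝ] E4) = 1 →
    (∀ i : Fin 4, ∃ j : Fin 4, R (EuclideanSpace.single i 1) = EuclideanSpace.single j 1 ∨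
      R (EuclideanSpace.single i 1) = -EuclideanSpace.single j 1) →
    ∀ (n : ℕ) (F : 𝓢((Fin n → E4), ℂ)), IsOffDiagonal F → S₁ n (linActMulti R F) = S₁ n F

/-- Reflection positivity in pull-back form for the EIGHT planar frames (time axis `a e₀ + b e₁`,
`a² + b² = 1`, `a = 0 ∨ b = 0 ∨ a² = b²`). -/
def EightFrameRP (S₁ : SchwingerFamily E4) : Prop :=
  ∀ (R : E4 ≃ₗᵢ[ℝ] E4) (a b : ℝ), a ^ 2 + b ^ 2 = 1 → (a = 0 ∨ b = 0 ∨ a ^ 2 = b ^ 2) →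
    R (EuclideanSpace.single 0 1) = a • EuclideanSpace.single 0 1 + b • EuclideanSpace.single 1 1 →
      (SchwingerFamily.toLabelled (fun n => (S₁ n).comp (linActMulti R))).IsReflectionPositive

/-- The planar spectral cone (verbatim the conclusion of `PlanarSpectralCone` at `S₁`). -/
def PlanarCone (S₁ : SchwingerFamily E4) : Prop :=
  ∀ (n m : ℕ) (F : 𝓢((Fin n → E4), ℂ)) (G : 𝓢((Fin m → E4), ℂ)), IsTimeOrdered F → IsTimeOrdered G →
    ∃ Φ : ℂ × ℂ → ℂ, DifferentiableOn ℂ Φ {w : ℂ × ℂ | |w.2.im| < w.1.re} ∧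
      (∀ (t b : ℝ), 0 < t → ∀ H : 𝓢((Fin (n + m) → E4), ℂ),
        IsAppendTensorOf H (osAdjoint F)
          (translateMulti (t • EuclideanSpace.single 0 1 + b • EuclideanSpace.single 1 1) G) →
          Φ ((t : ℂ), (b : ℂ)) = S₁ (n + m) H) ∧
      (∀ w ∈ {w : ℂ × ℂ | |w.2.im| < w.1.re}, ∀ (HF : 𝓢((Fin (n + n) → E4), ℂ))
        (HG : 𝓢((Fin (m + m) → E4), ℂ)), IsAppendTensorOf HF (osAdjoint F) F →
          IsAppendTensorOf HG (osAdjoint G) G → ‖Φ w‖ ^ 2 ≤ ‖S₁ (n + n) HF‖ * ‖S₁ (m + m) HG‖)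

/-- The conclusion: invariance on `⁰𝒮` under every determinant-one isometry fixing `e₂, e₃`
(all rotations of the `(x₀,x₁)`-plane), all `n`. -/
def PlanarInvariant (S₁ : SchwingerFamily E4) : Prop :=
  ∀ (R : E4 ≃ₗᵢ[ℝ] E4), LinearMap.det (R.toLinearEquiv : E4 →ₗ[ℝ] E4) = 1 →
    R (EuclideanSpace.single 2 1) = EuclideanSpace.single 2 1 →
    R (EuclideanSpace.single 3 1) = EuclideanSpace.single 3 1 →
      ∀ (n : ℕ) (F : 𝓢((Fin n → E4), ℂ)), IsOffDiagonal F → S₁ n (linActMulti R F) = S₁ n F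

/-- The same conclusion WITHOUT the restriction to `⁰𝒮` (equality of functionals on all of `𝓢`):
the natural strengthening refuted in §4. -/
def PlanarInvariantOnAllTests (S₁ : SchwingerFamily E4) : Prop :=
  ∀ (R : E4 ≃ₗᵢ[ℝ] E4), LinearMap.det (R.toLinearEquiv : E4 →ₗ[ℝ] E4) = 1 →
    R (EuclideanSpace.single 2 1) = EuclideanSpace.single 2 1 →
    R (EuclideanSpace.single 3 1) = EuclideanSpace.single 3 1 →
      ∀ (n : ℕ) (F : 𝓢((Fin n → E4), ℂ)), S₁ n (linActMulti R F) = S₁ n F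

section Lattice

variable {G : Type} [Group G] [TopologicalSpace G] [IsTopologicalGroup G] [CompactSpace G]
  [MeasurableSpace G] [BorelSpace G]

/-- The lattice TIE (first clause of `W₁`): convergence of the renormalised action-density strings
to `S₁` on off-diagonal real tensors, `n ≠ 0`. -/
def Tie (r : LatticeRep G) (sch : SpeciesScheme (YMSpecies G)) (S₁ : SchwingerFamily E4) : Prop :=
  ∀ (n : ℕ), n ≠ 0 → ∀ (f : Fin n → 𝓢(E4, ℝ)) (F : 𝓢((Fin n → E4), ℂ)),
    IsTensorOf F (fun i => ofRealTest (f i)) → IsOffDiagonal F →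
      Tendsto (fun k : ℕ => ((latticeSchwinger r.ρ sch (fun s => s.F) k n
        (fun _ => r.curvature) f : ℝ) : ℂ)) atTop (𝓝 (S₁ n F))

/-- The two gaps: continuum `HasMassGap` of `S₁` and the uniform lattice gap of the scheme. -/
def Gaps {κ : Type} (r : LatticeRep G) (sch : SpeciesScheme κ) (S₁ : SchwingerFamily E4) : Prop :=
  ∃ Δ : ℝ, 0 < Δ ∧ S₁.toLabelled.HasMassGap Δ ∧ HasLatticeMassGap r sch Δ

/-- The curvature-channel package `W₁ r sch S₁` of the crux, unbundled. -/
def W1 (r : LatticeRep G) (sch : SpeciesScheme (YMSpecies G)) (S₁ : SchwingerFamily E4) : Prop :=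
  Tie r sch S₁ ∧ OSPackage S₁ ∧ Translations S₁ ∧ Hypercubic S₁ ∧ Gaps r sch S₁

end Lattice

/-- **§0. The crux, unbundled** (definitional): for every compact simple `G` (Borel σ-algebra),
`W1 r sch S₁ → EightFrameRP S₁ → PlanarCone S₁ → PlanarInvariant S₁`. -/
theorem crux_iff :
    Summit.QuantumFields.YangMills.Theses.MirrorModularBoosts.CurvatureBoostCovariance ↔
      ∀ (G : Type) [Group G] [TopologicalSpace G] [IsTopologicalGroup G] [CompactSpace G],
        IsCompactSimpleLieGroup G →
        letI : MeasurableSpace G := borel G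
        haveI : BorelSpace G := ⟨rfl⟩
        ∀ (r : LatticeRep G) (sch : SpeciesScheme (YMSpecies G)) (S₁ : SchwingerFamily E4),
          W1 r sch S₁ → EightFrameRP S₁ → PlanarCone S₁ → PlanarInvariant S₁ :=
  Iff.rfl

/-- The natural strengthening of the crux: same hypotheses, conclusion on ALL test functions. -/
def CurvatureBoostCovarianceOnAllTests : Prop :=
  ∀ (G : Type) [Group G] [TopologicalSpace G] [IsTopologicalGroup G] [CompactSpace G],
    IsCompactSimpleLieGroup G →
    letI : MeasurableSpace G := borel G
    haveI : BorelSpace G := ⟨rfl⟩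
    ∀ (r : LatticeRep G) (sch : SpeciesScheme (YMSpecies G)) (S₁ : SchwingerFamily E4),
      W1 r sch S₁ → EightFrameRP S₁ → PlanarCone S₁ → PlanarInvariantOnAllTests S₁

/-! ## §1 The model-blind core -/

/-- **The model-blind core** of the crux: drop the gauge group, the lattice representation, the
scheme, the lattice tie and the lattice gap; keep every clause that speaks about `S₁` alone. -/
def ModelBlind : Prop :=
  ∀ (S₁ : SchwingerFamily E4), OSPackage S₁ → Translations S₁ → Hypercubic S₁ →
    (∃ Δ : ℝ, 0 < Δ ∧ S₁.toLabelled.HasMassGap Δ) → EightFrameRP S₁ → PlanarCone S₁ →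
      PlanarInvariant S₁

/-- **§1a. The model-blind core implies the crux** (the crux is the core restricted to Wilson
limits of the curvature channel).  Hence a PROOF of the crux that never uses the lattice tie is a
proof of `ModelBlind` — which is false (§1b): the tie is load-bearing for every proof. -/
theorem curvatureBoostCovariance_of_modelBlind (h : ModelBlind) :
    Summit.QuantumFields.YangMills.Theses.MirrorModularBoosts.CurvatureBoostCovariance := by
  rw [crux_iff]
  intro G _ _ _ _ _ r sch S₁ hW h8 hC
  exact h S₁ hW.2.1 hW.2.2.1 hW.2.2.2.1 (hW.2.2.2.2.imp fun Δ hΔ => ⟨hΔ.1, hΔ.2.1⟩) h8 hC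

/-- **§1b. NEAR-MISS (the one `sorry` of this file): the model-blind core is FALSE**, i.e. the
crux is `false_without_hconv` (without the lattice tie).

Paper witness (planner's retriage Gaussian, re-verified by this seat): the generalised free field
on `ℝ⁴` with two-point function `Ĉ(p) = P(p)/(p² + m²)`, `P(p) = 1 + ε·e₂(p₀²,p₁²,p₂²,p₃²)²`,
`e₂` the second elementary symmetric polynomial, `ε > 0`, `m > 0`, and `S_n` = hafnian of `C`.
* `P > 0` on `ℝ⁴`, so `C` is a positive (unbounded-kernel) covariance on `𝓢`: Minlos measure,
  moments are continuous multilinear ⇒ `OSPackage` minus E2 is routine (E0' with `β = 1/2`).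
* `P` is `W(B₄)`-invariant ⇒ `Hypercubic`, and translation invariant.
* RP across a mirror with unit normal `n` (any of the 16 of `W(B₄)`, in particular the eight
  planar frames): after rotating `n` to `e₀` (P is invariant), for `f` supported in `{x₀ > 0}`
  `⟨θf, C f⟩ = ∫ d³p⃗ P(-ω², p⃗²…) (π/ω) |∫ ds f̃(s,p⃗) e^{-ω s}|²`, `ω² = p⃗² + m²`
  (residue at `p₀ = iω`; the polynomial part of `Ĉ` is a contact term supported at `s = 0`,
  invisible for `s > 0`).  On the continued shell `p₀ = iω` every `p_μ²` is REAL, so `e₂` is real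
  and `P = 1 + ε(real)² ≥ 1 > 0`: RP holds in all 16 frames (Gaussian RP ⇐ covariance RP,
  Glimm–Jaffe Thm 6.2.2).  For the diagonal mirror `x₀ = x₁` use `u,v = (x₀ ± x₁)/√2`:
  `p₀² + p₁² = p_u² + p_v²`, `p₀²p₁² = (p_u² - p_v²)²/4`, real at `p_u = iω_u`.
* Gap and cone: the `e₀`-reconstruction is the Fock space over the one-particle space
  `L²(d³p⃗, P(-ω²,p⃗)π/ω)` with `H = Σ ω(p⃗ᵢ) ≥ m`, `P₁ = Σ pᵢ,₁`, and `ω(p⃗) ≥ |p₁|` gives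
  `H ≥ |P₁|`: `HasMassGap m`, `HasClusterProperty`, and `PlanarCone` (`Φ(ζ,β) = ⟨Ψ_F,
  e^{-ζH + iβP₁} Ψ_G⟩`, holomorphic with the Cauchy–Schwarz bound on `|Im β| < Re ζ`).
* NOT planar-rotation invariant ON `⁰𝒮`: for `x ≠ 0`, `C(x) = P(-∂²)G_m(x)` and the large-`|x|`
  asymptotics is `P(i m x̂) G_m ~ (1 + ε m⁸ e₂(x̂_μ²)²) G_m(|x|)`; `e₂(x̂²) = 0` at `x̂ = e₀` but
  `= 1/4` at `x̂ = (e₀+e₁)/√2`, two directions exchanged by the 45° rotation of the `(x₀,x₁)`-plane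
  fixing `e₂,e₃`: `S₂(f ⊗ g)` with far-separated disjoint bumps differs by the factor
  `1 + ε m⁸/16`.
Why not formalised: needs Gaussian Schwinger functions as CLMs on `𝓢((Fin n → ℝ⁴), ℂ)` (Fourier
transform on the `sup`-normed product, hafnian sums), eight reflection positivities of the Fock
functional, exponential clustering bounds and the two-variable holomorphic semigroup — several
thousand lines; no cheaper witness exists: classical mixtures of mirror-symmetric deterministic
fields that are RP-by-symmetry in the `e₀` AND `e₁` frames and translation invariant are
independent of `x₀,x₁` (hence planar invariant); finite-order families (`S_n = 0`, `n ≥ 3`) are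
killed by E2 (`S₄ = 0 ⇒ S₂ = 0` on time-ordered data); sheet-supported two-point functions
`Σ_μ δ(x^μ - y^μ) G₃` pass the axis frames but fail the diagonal frame (the mirror swaps the
sheets `Σ₀ ↔ Σ₁`, producing the indefinite cross term `2 Re ∫ ds ⟨φ_s, ψ_s⟩_OS`). -/
theorem curvatureBoostCovariance_false_without_hconv : ¬ ModelBlind := by
  sorry

/-! ## §2 The tie pins `S₁` on `⁰𝒮`; collapse of the `c ≡ 0` schemes -/

section TieLemmas

variable {G : Type} [Group G] [TopologicalSpace G] [IsTopologicalGroup G] [CompactSpace G]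
  [MeasurableSpace G] [BorelSpace G]

/-- **§2a. Uniqueness of the tied values.** Two families tied to the same `(r, sch)` agree on
every off-diagonal real tensor of positive degree: the tie PINS `S₁` there (limits in `ℂ` are
unique).  Since off-diagonal real tensors span a dense subspace of `⁰𝒮ₙ` and the conclusion reads
`S₁` only on `⁰𝒮`, a counterexample to the crux IS a Wilson scaling limit of the `tr F²` strings
that is not planar-rotation invariant — nothing less. -/
theorem tie_unique {r : LatticeRep G} {sch : SpeciesScheme (YMSpecies G)}
    {S₁ S₁' : SchwingerFamily E4} (h : Tie r sch S₁) (h' : Tie r sch S₁') {n : ℕ} (hn : n ≠ 0)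
    (f : Fin n → 𝓢(E4, ℝ)) (F : 𝓢((Fin n → E4), ℂ)) (hF : IsTensorOf F fun i => ofRealTest (f i))
    (hF' : IsOffDiagonal F) : S₁ n F = S₁' n F :=
  tendsto_nhds_unique (h n hn f F hF hF') (h' n hn f F hF hF')

/-- With the curvature's multiplicative renormalisation switched off (`c_k = 0`) every lattice
`n`-point function of the curvature string vanishes identically, `n ≠ 0`. -/
theorem latticeSchwinger_eq_zero_of_c_eq_zero (r : LatticeRep G) (sch : SpeciesScheme (YMSpecies G))
    (hc : ∀ k, sch.c r.curvature k = 0) (k : ℕ) {n : ℕ} (hn : n ≠ 0) (f : Fin n → 𝓢(E4, ℝ)) :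
    latticeSchwinger r.ρ sch (fun s => s.F) k n (fun _ => r.curvature) f = 0 := by
  obtain ⟨j, rfl⟩ := Nat.exists_eq_succ_of_ne_zero hn
  simp [latticeSchwinger, smearedLatticeField, hc k]

/-- **§2b. Collapse of the `c ≡ 0` schemes** (in particular `SpeciesScheme.zero`): a tied family
VANISHES on every off-diagonal real tensor of positive degree, whatever `β_k, m_k, a_k, L_k`. -/
theorem tie_apply_eq_zero_of_c_eq_zero {r : LatticeRep G} {sch : SpeciesScheme (YMSpecies G)}
    {S₁ : SchwingerFamily E4} (h : Tie r sch S₁) (hc : ∀ k, sch.c r.curvature k = 0) {n : ℕ}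
    (hn : n ≠ 0) (f : Fin n → 𝓢(E4, ℝ)) (F : 𝓢((Fin n → E4), ℂ))
    (hF : IsTensorOf F fun i => ofRealTest (f i)) (hF' : IsOffDiagonal F) : S₁ n F = 0 := by
  have ht := h n hn f F hF hF'
  simp only [latticeSchwinger_eq_zero_of_c_eq_zero r sch hc _ hn, Complex.ofReal_zero] at ht
  exact tendsto_nhds_unique ht tendsto_const_nhds

end TieLemmas

/-- `⁰𝒮` is stable under the diagonal action of a linear isometry. -/
theorem isOffDiagonal_linActMulti {n : ℕ} {F : 𝓢((Fin n → E4), ℂ)} (hF : IsOffDiagonal F)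
    (R : E4 ≃ₗᵢ[ℝ] E4) : IsOffDiagonal (linActMulti R F) := by
  intro x hx k
  set g : (Fin n → E4) ≃L[ℝ] (Fin n → E4) :=
    ContinuousLinearEquiv.piCongrRight fun _ : Fin n => R.symm.toContinuousLinearEquiv with hg
  have hfun : ((linActMulti R F : 𝓢((Fin n → E4), ℂ)) : (Fin n → E4) → ℂ) = (F : _ → ℂ) ∘ g := by
    funext y; rfl
  have hgx : g x ∈ coincidenceLocus n E4 := by
    obtain ⟨i, j, hij, hxij⟩ := hx
    exact ⟨i, j, hij, by simp [hg, hxij]⟩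
  have h0 : iteratedFDeriv ℝ k (F : (Fin n → E4) → ℂ) (g x) = 0 := hF _ hgx k
  have key := (g : (Fin n → E4) →L[ℝ] (Fin n → E4)).iteratedFDeriv_comp_right
    (F.smooth k) x (i := k) le_rfl
  simp only [ContinuousLinearEquiv.coe_coe] at key
  rw [hfun, key, h0]
  ext m
  simp

section TieLemmas2

variable {G : Type} [Group G] [TopologicalSpace G] [IsTopologicalGroup G] [CompactSpace G]
  [MeasurableSpace G] [BorelSpace G]

/-- **§2c. No counterexample from any `c ≡ 0` scheme**: a tied family is invariant on off-diagonal
real tensors under EVERY linear isometry of `ℝ⁴` (both sides vanish) — for the zero scheme the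
conclusion of the crux holds on tensors without E2, the cone, or any other clause. -/
theorem apply_linActMulti_eq_of_c_eq_zero {r : LatticeRep G} {sch : SpeciesScheme (YMSpecies G)}
    {S₁ : SchwingerFamily E4} (h : Tie r sch S₁) (hc : ∀ k, sch.c r.curvature k = 0)
    (R : E4 ≃ₗᵢ[ℝ] E4) {n : ℕ} (hn : n ≠ 0) (f : Fin n → 𝓢(E4, ℝ)) (F : 𝓢((Fin n → E4), ℂ))
    (hF : IsTensorOf F fun i => ofRealTest (f i)) (hF' : IsOffDiagonal F) :
    S₁ n (linActMulti R F) = S₁ n F := by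
  rw [tie_apply_eq_zero_of_c_eq_zero h hc hn f F hF hF',
    tie_apply_eq_zero_of_c_eq_zero h hc hn _ _ (hF.linActMulti R) (isOffDiagonal_linActMulti hF' R)]

end TieLemmas2


/-! ## §3 Non-vacuity: the vacuum family inhabits every hypothesis (every `G`, every `r`)

§3a (`β = 0` ⇒ the uniform lattice gap is automatic for EVERY `Δ`) is the LANDED theorem
`LatticeGapOnTrajectory.Negative.hasLatticeMassGap_of_zero_coupling` (p-landed support file of the sibling crux
`stmt-QuantumFields-10523`; first written by the HypercubicLimit / LatticeGapOnTrajectory disprovers) — imported,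
not re-proved.  Moral: `HasLatticeMassGap` constrains a witness only through the coupling sequence `β_k` it
shares with the tie. -/


/-! ### §3b The vacuum family -/

/-- The one-species VACUUM family `𝔖₀ = 1`, `𝔖ₙ = 0` (`n ≥ 1`). -/
def vac : SchwingerFamily E4 :=
  fun n => if n = 0 then LabelledSchwingerFamily.evalAt (0 : Fin n → E4) else 0

/-- `vac.toLabelled` is the tree's `LabelledSchwingerFamily.trivial Unit`. -/
theorem vac_toLabelled : vac.toLabelled = LabelledSchwingerFamily.trivial Unit E4 := rfl

/-- In degree `0` the vacuum family is evaluation (at any configuration). -/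
theorem vac_zero_apply (F : 𝓢((Fin 0 → E4), ℂ)) (x : Fin 0 → E4) : vac 0 F = F x := by
  show (if (0 : ℕ) = 0 then LabelledSchwingerFamily.evalAt (0 : Fin 0 → E4) else 0) F = F x
  rw [if_pos rfl, LabelledSchwingerFamily.evalAt_apply]
  exact congrArg F (Subsingleton.elim _ _)

/-- In degree `0` all configurations coincide. -/
theorem conj_mul_eq_fin0 (F G : 𝓢((Fin 0 → E4), ℂ)) (x y x' y' : Fin 0 → E4) :
    conj (F x) * G y = conj (F x') * G y' := by
  rw [Subsingleton.elim x x', Subsingleton.elim y y']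

/-- In positive degree the vacuum family vanishes. -/
theorem vac_of_ne_zero {n : ℕ} (hn : n ≠ 0) : vac n = 0 := by
  simp only [vac, if_neg hn]

/-- The vacuum family satisfies E0, E0', E2, E3, E4 (tree `OSAxiomsSchwinger.trivial`). -/
theorem osPackage_vac : OSPackage vac := by
  have h : OSAxiomsSchwinger (LabelledSchwingerFamily.trivial Unit E4) := OSAxiomsSchwinger.trivial Unit
  exact ⟨h.normalized, h.hermitian, h.linearGrowth, h.reflectionPositive, h.symmetric, h.cluster⟩

/-- The vacuum family is translation invariant on `⁰𝒮`. -/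
theorem translations_vac : Translations vac := fun n a F hF =>
  (OSAxiomsSchwinger.trivial (d := 4) Unit).invariant.1 n (fun _ => ()) a F hF

/-- The vacuum family is invariant on `⁰𝒮` under EVERY determinant-one isometry. -/
theorem apply_linActMulti_vac (R : E4 ≃ₗᵢ[ℝ] E4)
    (hR : LinearMap.det (R.toLinearEquiv : E4 →ₗ[ℝ] E4) = 1) (n : ℕ) (F : 𝓢((Fin n → E4), ℂ))
    (hF : IsOffDiagonal F) : vac n (linActMulti R F) = vac n F :=
  (OSAxiomsSchwinger.trivial (d := 4) Unit).invariant.2 n (fun _ => ()) R hR F hF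

/-- The vacuum family is invariant under the proper signed permutations. -/
theorem hypercubic_vac : Hypercubic vac := fun R hR _ n F hF => apply_linActMulti_vac R hR n F hF

/-- The vacuum family is planar-rotation invariant on `⁰𝒮` (the crux's conclusion). -/
theorem planarInvariant_vac : PlanarInvariant vac := fun R hR _ _ n F hF =>
  apply_linActMulti_vac R hR n F hF

/-- The vacuum family has every mass gap. -/
theorem hasMassGap_vac (Δ : ℝ) : vac.toLabelled.HasMassGap Δ :=
  OSData.vacuum_hasMassGap (ι := Unit) (d := 4) Δ

/-- Pulling the vacuum family back by any frame gives the vacuum family. -/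
theorem pullback_vac (R : E4 ≃ₗᵢ[ℝ] E4) : (fun n => (vac n).comp (linActMulti R)) = vac := by
  funext n
  rcases Nat.eq_zero_or_pos n with rfl | hn
  · ext F
    rw [ContinuousLinearMap.comp_apply, vac_zero_apply _ (0 : Fin 0 → E4),
      vac_zero_apply F (0 : Fin 0 → E4), linActMulti_apply]
    exact congrArg F (Subsingleton.elim _ _)
  · rw [vac_of_ne_zero hn.ne', ContinuousLinearMap.zero_comp]

/-- The vacuum family is reflection positive in the eight planar frames. -/
theorem eightFrameRP_vac : EightFrameRP vac := by
  intro R a b _ _ _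
  rw [pullback_vac R]
  exact osPackage_vac.2.2.2.1

/-- The vacuum family has the planar cone: `Φ` is the constant `conj F(∅) G(∅)` in degree `0 + 0`
and `0` otherwise. -/
theorem planarCone_vac : PlanarCone vac := by
  intro n m F G _ _
  by_cases hnm : n + m = 0
  · obtain ⟨rfl, rfl⟩ : n = 0 ∧ m = 0 := by omega
    haveI hE : IsEmpty (Fin (0 + 0)) := (inferInstance : IsEmpty (Fin 0))
    refine ⟨fun _ => conj (F 0) * G 0, differentiableOn_const _, fun t b _ H hH => ?_,
      fun w _ HF HG hHF hHG => ?_⟩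
    · rw [vac_zero_apply H 0, hH, osAdjoint_apply, translateMulti_apply]
      exact conj_mul_eq_fin0 F G _ _ _ _
    · have h1 : vac (0 + 0) HF = conj (F 0) * F 0 := by
        rw [vac_zero_apply HF 0, hHF, osAdjoint_apply]
        exact conj_mul_eq_fin0 F F _ _ _ _
      have h2 : vac (0 + 0) HG = conj (G 0) * G 0 := by
        rw [vac_zero_apply HG 0, hHG, osAdjoint_apply]
        exact conj_mul_eq_fin0 G G _ _ _ _
      rw [h1, h2, norm_mul, norm_mul, norm_mul, Complex.norm_conj, Complex.norm_conj]
      exact le_of_eq (by ring)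
  · refine ⟨fun _ => 0, differentiableOn_const _, fun t b _ H _ => ?_, fun w _ HF HG _ _ => ?_⟩
    · simp [vac_of_ne_zero hnm]
    · simp only [norm_zero, ne_eq, OfNat.ofNat_ne_zero, not_false_eq_true, zero_pow]
      positivity

section VacuumLattice

variable {G : Type} [Group G] [TopologicalSpace G] [IsTopologicalGroup G] [CompactSpace G]
  [MeasurableSpace G] [BorelSpace G]

/-- The vacuum family is tied to every scheme with `c_k = 0` on the curvature (e.g. the zero
scheme), for every `G`, `r`. -/
theorem tie_vac (r : LatticeRep G) (sch : SpeciesScheme (YMSpecies G))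
    (hc : ∀ k, sch.c r.curvature k = 0) : Tie r sch vac := by
  intro n hn f F _ _
  have h0 : ∀ k, ((latticeSchwinger r.ρ sch (fun s => s.F) k n (fun _ => r.curvature) f : ℝ) : ℂ)
      = 0 := fun k => by
    rw [latticeSchwinger_eq_zero_of_c_eq_zero r sch hc k hn, Complex.ofReal_zero]
  simp only [h0, vac_of_ne_zero hn]
  exact tendsto_const_nhds

/-- **§3c. NON-VACUITY of the whole hypothesis set**: for EVERY compact group `G` and EVERY
lattice representation `r`, the zero scheme and the vacuum family satisfy `W₁`, the eight-frame
RP and the planar cone (and, of course, the conclusion).  The hypotheses of the crux are jointly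
satisfiable; the crux is not vacuous and not junk-refutable (`W₁` carries no non-triviality). -/
theorem hypotheses_vac (r : LatticeRep G) :
    W1 r (SpeciesScheme.zero _) vac ∧ EightFrameRP vac ∧ PlanarCone vac ∧ PlanarInvariant vac :=
  ⟨⟨tie_vac r _ fun _ => rfl, osPackage_vac, translations_vac, hypercubic_vac,
    ⟨1, one_pos, hasMassGap_vac 1, Theorems.LatticeGapOnTrajectory.Negative.hasLatticeMassGap_of_zero_coupling r _ (fun _ => rfl) 1⟩⟩,
    eightFrameRP_vac, planarCone_vac, planarInvariant_vac⟩

end VacuumLattice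


/-! ## §4 The natural strengthening "invariance as equality of functionals on all of `𝓢`" is FALSE

Witness `S♯` = vacuum family + (degree 3) evaluation at the constant configuration `(e₁,e₁,e₁)`.
Every hypothesis of the crux reads `S₁` only on `⁰𝒮`, on time-ordered data, or in degree `0`
— and a constant configuration of `≥ 2` points is in the coincidence locus and is never strictly
time-ordered — so `S♯` inherits every hypothesis from the vacuum (for every `G`, `r`, zero
scheme); but the half-turn `diag(-1,-1,1,1)` of the `(x₀,x₁)`-plane moves `(e₁,e₁,e₁)` to
`(-e₁,-e₁,-e₁)`.  Message to provers: state and prove invariance ON `⁰𝒮` only; nothing pins a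
tied family at coincident points. -/

/-- `e₁ = (0,1,0,0)`. -/
def e1 : E4 := EuclideanSpace.single 1 (1 : ℝ)

/-- A time-ordered test function of degree `≥ 2` vanishes at every constant configuration
(equal times are not strictly increasing). -/
theorem apply_const_eq_zero_of_isTimeOrdered {n : ℕ} {F : 𝓢((Fin n → E4), ℂ)}
    (hF : IsTimeOrdered F) (hn : 2 ≤ n) (p : E4) : F (fun _ => p) = 0 := by
  refine image_eq_zero_of_notMem_tsupport fun hmem => ?_
  have h := (hF hmem).2
  have h01 : (⟨0, by omega⟩ : Fin n) < ⟨1, by omega⟩ := Fin.mk_lt_mk.2 zero_lt_one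
  exact lt_irrefl _ (h h01)

/-- … and so does its OS adjoint. -/
theorem osAdjoint_apply_const_eq_zero {n : ℕ} {F : 𝓢((Fin n → E4), ℂ)}
    (hF : IsTimeOrdered F) (hn : 2 ≤ n) (p : E4) : osAdjoint F (fun _ => p) = 0 := by
  rw [osAdjoint_apply]
  show conj (F fun _ => timeReflection 4 p) = 0
  rw [apply_const_eq_zero_of_isTimeOrdered hF hn, map_zero]

/-- **Master vanishing lemma.** A tensor witness of `θF* ⊗ G_{(v)}` with `F, G` time-ordered of
total degree `≥ 3` vanishes at every constant configuration (one factor has degree `≥ 2`). -/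
theorem append_apply_const_eq_zero {n m : ℕ} {F : 𝓢((Fin n → E4), ℂ)} {G : 𝓢((Fin m → E4), ℂ)}
    (hF : IsTimeOrdered F) (hG : IsTimeOrdered G) (h3 : 3 ≤ n + m) (v : E4)
    {H : 𝓢((Fin (n + m) → E4), ℂ)} (hH : IsAppendTensorOf H (osAdjoint F) (translateMulti v G))
    (p : E4) : H (fun _ => p) = 0 := by
  rw [hH]
  rcases le_or_gt 2 n with hn | hn
  · have h0 : osAdjoint F ((fun _ : Fin (n + m) => p) ∘ Fin.castAdd m) = 0 :=
      osAdjoint_apply_const_eq_zero hF hn p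
    rw [h0, zero_mul]
  · have hm : 2 ≤ m := by omega
    have h0 : translateMulti v G ((fun _ : Fin (n + m) => p) ∘ Fin.natAdd n) = 0 := by
      rw [translateMulti_apply]
      exact apply_const_eq_zero_of_isTimeOrdered hG hm (p - v)
    rw [h0, mul_zero]

/-- The same without translation (`θF* ⊗ G`, as in E2). -/
theorem append_apply_const_eq_zero' {n m : ℕ} {F : 𝓢((Fin n → E4), ℂ)} {G : 𝓢((Fin m → E4), ℂ)}
    (hF : IsTimeOrdered F) (hG : IsTimeOrdered G) (h3 : 3 ≤ n + m)
    {H : 𝓢((Fin (n + m) → E4), ℂ)} (hH : IsAppendTensorOf H (osAdjoint F) G)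
    (p : E4) : H (fun _ => p) = 0 := by
  rw [hH]
  rcases le_or_gt 2 n with hn | hn
  · have h0 : osAdjoint F ((fun _ : Fin (n + m) => p) ∘ Fin.castAdd m) = 0 :=
      osAdjoint_apply_const_eq_zero hF hn p
    rw [h0, zero_mul]
  · have hm : 2 ≤ m := by omega
    have h0 : G ((fun _ : Fin (n + m) => p) ∘ Fin.natAdd n) = 0 :=
      apply_const_eq_zero_of_isTimeOrdered hG hm p
    rw [h0, mul_zero]

/-- **The witness `S♯`**: the vacuum family plus, in degree `3`, evaluation at `(e₁,e₁,e₁)`. -/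
def sharp : SchwingerFamily E4 :=
  fun n => if n = 3 then LabelledSchwingerFamily.evalAt (fun _ : Fin n => e1) else vac n

/-- Off degree `3`, `S♯` is the vacuum family. -/
theorem sharp_of_ne {n : ℕ} (hn : n ≠ 3) : sharp n = vac n := if_neg hn

/-- In degree `3`, `S♯` is evaluation at `(e₁,e₁,e₁)`. -/
theorem sharp_three_apply (F : 𝓢((Fin 3 → E4), ℂ)) : sharp 3 F = F (fun _ => e1) := rfl

/-- `S♯` agrees with the vacuum on every test function vanishing at `(e₁,e₁,e₁)` (degree 3). -/
theorem sharp_apply_eq_vac {n : ℕ} (F : 𝓢((Fin n → E4), ℂ)) (h : n = 3 → F (fun _ => e1) = 0) :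
    sharp n F = vac n F := by
  by_cases hn : n = 3
  · subst hn
    rw [sharp_three_apply, h rfl, vac_of_ne_zero (by norm_num)]
    rfl
  · rw [sharp_of_ne hn]

/-- A constant configuration of `3` points is coincident. -/
theorem const_mem_coincidenceLocus (p : E4) : (fun _ : Fin 3 => p) ∈ coincidenceLocus 3 E4 :=
  ⟨0, 1, by decide, rfl⟩

/-- `S♯ = vacuum` on `⁰𝒮`. -/
theorem sharp_apply_offDiagonal {n : ℕ} (F : 𝓢((Fin n → E4), ℂ)) (hF : IsOffDiagonal F) :
    sharp n F = vac n F :=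
  sharp_apply_eq_vac F fun h3 => by subst h3; exact hF.apply_eq_zero (const_mem_coincidenceLocus e1)

/-- E2 for any one-species family whose values on E2-data are the vacuum's. -/
theorem isReflectionPositive_of_eq_vac (T : SchwingerFamily E4)
    (hT : ∀ (n m : ℕ) (F : 𝓢((Fin n → E4), ℂ)) (G : 𝓢((Fin m → E4), ℂ)),
      IsTimeOrdered F → IsTimeOrdered G → ∀ H : 𝓢((Fin (n + m) → E4), ℂ),
        IsAppendTensorOf H (osAdjoint F) G → T (n + m) H = vac (n + m) H) :
    T.toLabelled.IsReflectionPositive := by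
  intro N deg lab F hF H hH
  have hsum : (∑ i, ∑ j, T.toLabelled (deg i + deg j) (Fin.append (lab i ∘ Fin.rev) (lab j)) (H i j))
      = ∑ i, ∑ j, vac.toLabelled (deg i + deg j) (Fin.append (lab i ∘ Fin.rev) (lab j)) (H i j) :=
    Finset.sum_congr rfl fun i _ => Finset.sum_congr rfl fun j _ =>
      hT _ _ _ _ (hF i) (hF j) _ (hH i j)
  have hv := osPackage_vac.2.2.2.1 N deg lab F hF H hH
  dsimp only at hv ⊢
  rw [hsum]
  exact hv

/-- `S♯` on E2-data of every frame is the vacuum: total degree `3` never survives a constant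
configuration, other degrees are the vacuum by definition. -/
theorem sharp_pullback_append_eq_vac (R : E4 ≃ₗᵢ[ℝ] E4) {n m : ℕ} {F : 𝓢((Fin n → E4), ℂ)}
    {G : 𝓢((Fin m → E4), ℂ)} (hF : IsTimeOrdered F) (hG : IsTimeOrdered G)
    (H : 𝓢((Fin (n + m) → E4), ℂ)) (hH : IsAppendTensorOf H (osAdjoint F) G) :
    sharp (n + m) (linActMulti R H) = vac (n + m) H := by
  rw [sharp_apply_eq_vac (linActMulti R H) fun h3 => by
    rw [linActMulti_apply]
    exact append_apply_const_eq_zero' hF hG h3.ge hH (R.symm e1)]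
  show (fun k => (vac k).comp (linActMulti R)) (n + m) H = vac (n + m) H
  rw [pullback_vac R]

/-- `S♯` is reflection positive in pull-back form in EVERY frame (all isometries `R`). -/
theorem isReflectionPositive_sharp_pullback (R : E4 ≃ₗᵢ[ℝ] E4) :
    (SchwingerFamily.toLabelled (fun n => (sharp n).comp (linActMulti R))).IsReflectionPositive :=
  isReflectionPositive_of_eq_vac _ fun _ _ _ _ hF hG H hH =>
    sharp_pullback_append_eq_vac R hF hG H hH

/-- `S♯` is reflection positive in the eight planar frames. -/
theorem eightFrameRP_sharp : EightFrameRP sharp := fun R _ _ _ _ _ =>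
  isReflectionPositive_sharp_pullback R

/-- `S♯` is reflection positive along `e₀`. -/
theorem isReflectionPositive_sharp : sharp.toLabelled.IsReflectionPositive :=
  isReflectionPositive_of_eq_vac _ fun _ _ _ _ hF hG H hH =>
    sharp_apply_eq_vac H fun h3 => append_apply_const_eq_zero' hF hG h3.ge hH e1

/-- `S♯` satisfies E0, E0', E2, E3, E4. -/
theorem osPackage_sharp : OSPackage sharp := by
  obtain ⟨h0, hh, hg, -, hs, hc⟩ := osPackage_vac
  refine ⟨fun k F => ?_, fun n k F hF => ?_, fun T => ?_, isReflectionPositive_sharp,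
    fun n k π F hF => ?_, fun n m k k' F G hF hG a ha0 ha H hH => ?_⟩
  · -- E0 normalisation: degree 0 is the vacuum
    exact h0 k F
  · -- E0 hermiticity on time-ordered data
    have e1' : sharp n F = vac n F := sharp_apply_eq_vac F fun h3 => by
      subst h3; exact apply_const_eq_zero_of_isTimeOrdered hF (by norm_num) e1
    have e2' : sharp n (osAdjoint F) = vac n (osAdjoint F) := sharp_apply_eq_vac _ fun h3 => by
      subst h3; exact osAdjoint_apply_const_eq_zero hF (by norm_num) e1
    simp only [SchwingerFamily.toLabelled_apply] at hh ⊢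
    rw [e1', e2']
    exact hh n k F hF
  · -- E0' on ⁰𝒮
    obtain ⟨s, α, β, hαβ⟩ := hg T
    refine ⟨s, α, β, fun n k hk F hF => ?_⟩
    simp only [SchwingerFamily.toLabelled_apply] at hαβ ⊢
    rw [sharp_apply_offDiagonal F hF]
    exact hαβ n k hk F hF
  · -- E3 on ⁰𝒮
    simp only [SchwingerFamily.toLabelled_apply] at hs ⊢
    rw [sharp_apply_offDiagonal F hF, sharp_apply_eq_vac (permTest π F) fun h3 => by
      subst h3; rw [permTest_apply]; exact hF.apply_eq_zero (const_mem_coincidenceLocus e1)]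
    exact hs n k π F hF
  · -- E4
    simp only [SchwingerFamily.toLabelled_apply] at hc ⊢
    have hfun : (fun t : ℝ => sharp (n + m) (H t) - sharp n (osAdjoint F) * sharp m G) =
        fun t : ℝ => vac (n + m) (H t) - vac n (osAdjoint F) * vac m G := by
      funext t
      rw [sharp_apply_eq_vac (H t) fun h3 => append_apply_const_eq_zero hF hG h3.ge _ (hH t) e1,
        sharp_apply_eq_vac (osAdjoint F) fun h3 => by
          subst h3; exact osAdjoint_apply_const_eq_zero hF (by norm_num) e1,
        sharp_apply_eq_vac G fun h3 => by
          subst h3; exact apply_const_eq_zero_of_isTimeOrdered hG (by norm_num) e1]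
    rw [hfun]
    exact hc n m k k' F G hF hG a ha0 ha H hH

/-- `S♯` is translation invariant on `⁰𝒮`. -/
theorem translations_sharp : Translations sharp := by
  intro n a F hF
  rw [sharp_apply_offDiagonal F hF, sharp_apply_eq_vac (translateMulti a F) fun h3 => by
    subst h3; rw [translateMulti_apply]; exact hF.apply_eq_zero (const_mem_coincidenceLocus _)]
  exact translations_vac n a F hF

/-- `S♯` is invariant ON `⁰𝒮` under every determinant-one isometry (like the vacuum). -/
theorem apply_linActMulti_sharp (R : E4 ≃ₗᵢ[ℝ] E4)
    (hR : LinearMap.det (R.toLinearEquiv : E4 →ₗ[ℝ] E4) = 1) (n : ℕ) (F : 𝓢((Fin n → E4), ℂ))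
    (hF : IsOffDiagonal F) : sharp n (linActMulti R F) = sharp n F := by
  rw [sharp_apply_offDiagonal F hF, sharp_apply_eq_vac (linActMulti R F) fun h3 => by
    subst h3; rw [linActMulti_apply]; exact hF.apply_eq_zero (const_mem_coincidenceLocus _)]
  exact apply_linActMulti_vac R hR n F hF

/-- `S♯` is invariant under the proper signed permutations on `⁰𝒮`. -/
theorem hypercubic_sharp : Hypercubic sharp := fun R hR _ n F hF => apply_linActMulti_sharp R hR n F hF

/-- `S♯` satisfies the crux's conclusion (on `⁰𝒮`). -/
theorem planarInvariant_sharp : PlanarInvariant sharp := fun R hR _ _ n F hF =>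
  apply_linActMulti_sharp R hR n F hF

/-- `S♯` has every mass gap. -/
theorem hasMassGap_sharp (Δ : ℝ) : sharp.toLabelled.HasMassGap Δ := by
  intro n m k k' F G hF hG
  obtain ⟨C, hC⟩ := hasMassGap_vac Δ n m k k' F G hF hG
  refine ⟨C, fun t ht H hH => ?_⟩
  simp only [SchwingerFamily.toLabelled_apply] at hC ⊢
  rw [sharp_apply_eq_vac H fun h3 => append_apply_const_eq_zero hF hG h3.ge _ hH e1,
    sharp_apply_eq_vac (osAdjoint F) fun h3 => by
      subst h3; exact osAdjoint_apply_const_eq_zero hF (by norm_num) e1,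
    sharp_apply_eq_vac G fun h3 => by
      subst h3; exact apply_const_eq_zero_of_isTimeOrdered hG (by norm_num) e1]
  exact hC t ht H hH

/-- `S♯` has the planar cone. -/
theorem planarCone_sharp : PlanarCone sharp := by
  intro n m F G hF hG
  obtain ⟨Φ, hΦ, h2, h3⟩ := planarCone_vac n m F G hF hG
  refine ⟨Φ, hΦ, fun t b ht H hH => ?_, fun w hw HF HG hHF hHG => ?_⟩
  · rw [h2 t b ht H hH, sharp_apply_eq_vac H fun h3 => append_apply_const_eq_zero hF hG h3.ge _ hH e1]
  · rw [sharp_of_ne (by omega : n + n ≠ 3), sharp_of_ne (by omega : m + m ≠ 3)]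
    exact h3 w hw HF HG hHF hHG

section SharpLattice

variable {G : Type} [Group G] [TopologicalSpace G] [IsTopologicalGroup G] [CompactSpace G]
  [MeasurableSpace G] [BorelSpace G]

/-- `S♯` is tied to every scheme with `c_k = 0` on the curvature. -/
theorem tie_sharp (r : LatticeRep G) (sch : SpeciesScheme (YMSpecies G))
    (hc : ∀ k, sch.c r.curvature k = 0) : Tie r sch sharp := by
  intro n hn f F hF hF'
  rw [sharp_apply_offDiagonal F hF']
  exact tie_vac r sch hc n hn f F hF hF'

/-- **`S♯` satisfies EVERY hypothesis of the crux** (any `G`, any `r`, zero scheme) and the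
conclusion on `⁰𝒮`. -/
theorem hypotheses_sharp (r : LatticeRep G) :
    W1 r (SpeciesScheme.zero _) sharp ∧ EightFrameRP sharp ∧ PlanarCone sharp ∧
      PlanarInvariant sharp :=
  ⟨⟨tie_sharp r _ fun _ => rfl, osPackage_sharp, translations_sharp, hypercubic_sharp,
    ⟨1, one_pos, hasMassGap_sharp 1, Theorems.LatticeGapOnTrajectory.Negative.hasLatticeMassGap_of_zero_coupling r _ (fun _ => rfl) 1⟩⟩,
    eightFrameRP_sharp, planarCone_sharp, planarInvariant_sharp⟩

end SharpLattice

/-! ### The half-turn of the `(x₀,x₁)`-plane and the bump at `(e₁,e₁,e₁)` -/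

/-- Reflection in the hyperplane orthogonal to the axis `eᵢ`. -/
def axisReflection (i : Fin 4) : E4 ≃ₗᵢ[ℝ] E4 :=
  (ℝ ∙ (EuclideanSpace.single i (1 : ℝ) : E4))ᗮ.reflection

/-- The half-turn `diag(-1,-1,1,1)` = reflection along `e₀` then along `e₁`. -/
def halfTurn : E4 ≃ₗᵢ[ℝ] E4 := (axisReflection 0).trans (axisReflection 1)

/-- The coordinate vectors are non-zero. -/
theorem single_ne_zero (i : Fin 4) : (EuclideanSpace.single i (1 : ℝ) : E4) ≠ 0 := by
  intro h
  have := congrArg (fun v : E4 => v i) h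
  simp at this

/-- An axis reflection has determinant `-1`. -/
theorem det_axisReflection (i : Fin 4) :
    LinearMap.det ((axisReflection i).toLinearEquiv : E4 →ₗ[ℝ] E4) = -1 := by
  have h := ((ℝ ∙ (EuclideanSpace.single i (1 : ℝ) : E4))ᗮ).det_reflection
  rw [Submodule.orthogonal_orthogonal, finrank_span_singleton (single_ne_zero i), pow_one] at h
  exact h

/-- Determinants multiply under composition of isometries. -/
theorem det_trans (A B : E4 ≃ₗᵢ[ℝ] E4) :
    LinearMap.det ((A.trans B).toLinearEquiv : E4 →ₗ[ℝ] E4) =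
      LinearMap.det (B.toLinearEquiv : E4 →ₗ[ℝ] E4) * LinearMap.det (A.toLinearEquiv : E4 →ₗ[ℝ] E4) := by
  rw [← LinearMap.det_comp]
  rfl

/-- The half-turn has determinant `1`. -/
theorem det_halfTurn : LinearMap.det (halfTurn.toLinearEquiv : E4 →ₗ[ℝ] E4) = 1 := by
  rw [halfTurn, det_trans, det_axisReflection, det_axisReflection]
  norm_num

/-- Distinct coordinate vectors are orthogonal. -/
theorem single_mem_orthogonal {i j : Fin 4} (hij : i ≠ j) :
    (EuclideanSpace.single j (1 : ℝ) : E4) ∈ (ℝ ∙ (EuclideanSpace.single i (1 : ℝ) : E4))ᗮ := by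
  rw [Submodule.mem_orthogonal_singleton_iff_inner_right, EuclideanSpace.inner_single_left]
  simp [hij.symm]

/-- An axis reflection fixes the other coordinate vectors. -/
theorem axisReflection_single_of_ne {i j : Fin 4} (hij : i ≠ j) :
    axisReflection i (EuclideanSpace.single j 1) = EuclideanSpace.single j 1 :=
  Submodule.reflection_mem_subspace_eq_self (single_mem_orthogonal hij)

/-- An axis reflection negates its own coordinate vector. -/
theorem axisReflection_single_self (i : Fin 4) :
    axisReflection i (EuclideanSpace.single i 1) = -EuclideanSpace.single i 1 :=
  Submodule.reflection_orthogonalComplement_singleton_eq_neg _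

/-- The half-turn fixes `e₂`. -/
theorem halfTurn_single_two : halfTurn (EuclideanSpace.single 2 1) = EuclideanSpace.single 2 1 := by
  show axisReflection 1 (axisReflection 0 (EuclideanSpace.single 2 1)) = _
  rw [axisReflection_single_of_ne (by decide), axisReflection_single_of_ne (by decide)]

/-- The half-turn fixes `e₃`. -/
theorem halfTurn_single_three : halfTurn (EuclideanSpace.single 3 1) = EuclideanSpace.single 3 1 := by
  show axisReflection 1 (axisReflection 0 (EuclideanSpace.single 3 1)) = _
  rw [axisReflection_single_of_ne (by decide), axisReflection_single_of_ne (by decide)]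

/-- The half-turn negates `e₁`. -/
theorem halfTurn_e1 : halfTurn e1 = -e1 := by
  show axisReflection 1 (axisReflection 0 (EuclideanSpace.single 1 1)) = -EuclideanSpace.single 1 1
  rw [axisReflection_single_of_ne (by decide), axisReflection_single_self]

/-- The inverse half-turn negates `e₁`. -/
theorem halfTurn_symm_e1 : halfTurn.symm e1 = -e1 := by
  have h : halfTurn (-e1) = e1 := by rw [map_neg, halfTurn_e1, neg_neg]
  calc halfTurn.symm e1 = halfTurn.symm (halfTurn (-e1)) := by rw [h]
    _ = -e1 := halfTurn.symm_apply_apply _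

/-- A test function of degree 3 that is `1` at `(e₁,e₁,e₁)` and `0` at `(-e₁,-e₁,-e₁)`
(a smooth bump of outer radius `1` in the `sup`-distance; the two configurations are `2` apart). -/
theorem exists_bump_three :
    ∃ F : 𝓢((Fin 3 → E4), ℂ), F (fun _ => e1) = 1 ∧ F (fun _ => -e1) = 0 := by
  let c : Fin 3 → E4 := fun _ => e1
  let f : ContDiffBump c := ⟨1 / 2, 1, by norm_num, by norm_num⟩
  have hcs : HasCompactSupport fun y => ((f y : ℝ) : ℂ) := f.hasCompactSupport.comp_left Complex.ofReal_zero
  have hcd : ContDiff ℝ ((⊤ : ℕ∞) : WithTop ℕ∞) fun y => ((f y : ℝ) : ℂ) :=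
    Complex.ofRealCLM.contDiff.comp f.contDiff
  refine ⟨hcs.toSchwartzMap hcd, ?_, ?_⟩
  · show ((f c : ℝ) : ℂ) = 1
    rw [f.one_of_mem_closedBall (Metric.mem_closedBall_self (by norm_num))]
    simp
  · show ((f (fun _ => -e1) : ℝ) : ℂ) = 0
    have hdist : dist (fun _ : Fin 3 => -e1) c = 2 := by
      show dist (fun _ : Fin 3 => -e1) (fun _ : Fin 3 => e1) = 2
      rw [dist_pi_const, dist_eq_norm, show (-e1 - e1 : E4) = (-2 : ℝ) • e1 by
        rw [neg_smul, two_smul, neg_add, sub_eq_add_neg], norm_smul, e1, PiLp.norm_single]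
      norm_num
    rw [f.zero_of_le_dist (by rw [hdist]; norm_num)]
    simp

/-- **§4. THE NATURAL STRENGTHENING IS FALSE**: with the conclusion stated on ALL test
functions (not only on `⁰𝒮`) the crux fails — `G = SU(2)`, `r` = fundamental representation,
the zero scheme, `S₁ = S♯`, the half-turn of the `(x₀,x₁)`-plane and the bump at `(e₁,e₁,e₁)`:
`S♯₃(bump ∘ halfTurn⁻¹) = bump(-e₁,-e₁,-e₁) = 0 ≠ 1 = S♯₃(bump)`. -/
theorem not_curvatureBoostCovarianceOnAllTests : ¬ CurvatureBoostCovarianceOnAllTests := by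
  intro h
  have hG : IsCompactSimpleLieGroup (Matrix.specialUnitaryGroup (Fin 2) ℂ) :=
    isCompactSimpleLieGroup_specialUnitaryGroup isSimpleCompactGroup_specialUnitaryGroup_holds le_rfl
  letI : MeasurableSpace (Matrix.specialUnitaryGroup (Fin 2) ℂ) := borel _
  haveI : BorelSpace (Matrix.specialUnitaryGroup (Fin 2) ℂ) := ⟨rfl⟩
  let r : LatticeRep (Matrix.specialUnitaryGroup (Fin 2) ℂ) :=
    ⟨2, fundamentalRep (Fin 2), continuous_fundamentalRep _, fundamentalRep_injective _,
      fundamentalRep_mem_unitaryGroup⟩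
  obtain ⟨hW, h8, hC, -⟩ := hypotheses_sharp r
  have key := h (Matrix.specialUnitaryGroup (Fin 2) ℂ) hG r (SpeciesScheme.zero _) sharp hW h8 hC
    halfTurn det_halfTurn halfTurn_single_two halfTurn_single_three 3
  obtain ⟨F, hF1, hF0⟩ := exists_bump_three
  have h1 := key F
  rw [sharp_three_apply, sharp_three_apply, linActMulti_apply] at h1
  simp only [halfTurn_symm_e1] at h1
  rw [hF0, hF1] at h1
  exact zero_ne_one h1


/-! ## §6 The `β ≡ 0` COLLAPSE in Lean: any `c_k, m_k, a_k, L_k`, any faithful `ρ`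

At `β = 0` the torus Wilson measure is product Haar.  The centred plaquette observable
`Re tr ρ(U_p) − d₀`, `d₀ = ∫ Re tr ρ dHaar`, averages to zero over any ONE of its links with the
other three held fixed (right invariance of Haar), and among fewer than `side` pairwise distinct
base points on the torus there is always a plaquette with a PRIVATE link (the torus-minimal base
point: per-coordinate missing residue classes give wrap-free heights, minimise the total height).
Hence the product of translated action densities integrates like a product of constants
(`integral_prod_actionDensity_sub`), the lattice `n`-point function of the curvature on an
off-diagonal real tensor is EXACTLY `(c_k(6d₀ − m_k))ⁿ ∏ᵢ a_k⁴ Σ fᵢ(a_k y)`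
(`latticeSchwinger_beta_zero`), a tied family is a c-number field on those tensors
(`tie_beta_zero_factorises`), and the conclusion of the crux — for EVERY isometry — reduces to
the one-point distribution (`apply_linActMulti_eq_of_beta_zero`).  No information, positive or
negative, can come from `β ≡ 0`. -/



section Resample

variable {ι X : Type*} [Fintype ι] [DecidableEq ι] [MeasurableSpace X]

omit [Fintype ι] [MeasurableSpace X] in
/-- Preimage of a box under the one-coordinate update map `(U, g) ↦ U[i₀ ↦ g]`. -/
theorem update_preimage_univ_pi_prod (i₀ : ι) (s : ι → Set X) :
    (fun p : (ι → X) × X => Function.update p.1 i₀ p.2) ⁻¹' Set.pi Set.univ s =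
      (Set.pi Set.univ (Function.update s i₀ Set.univ)) ×ˢ s i₀ := by
  ext ⟨U, g⟩
  simp only [Set.mem_preimage, Set.mem_prod, Set.mem_univ_pi]
  constructor
  · intro H
    refine ⟨fun j => ?_, by simpa using H i₀⟩
    by_cases hj : j = i₀
    · subst hj; simp
    · simpa [Function.update_of_ne hj] using H j
  · rintro ⟨H1, H2⟩ j
    by_cases hj : j = i₀
    · subst hj; simpa using H2
    · simpa [Function.update_of_ne hj] using H1 j

/-- **The one-coordinate update map pushes `μ₀^{⊗ι} ⊗ μ₀` forward to `μ₀^{⊗ι}`** (`μ₀` a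
probability measure). -/
theorem map_update_pi_prod (μ₀ : Measure X) [IsProbabilityMeasure μ₀] (i₀ : ι) :
    Measure.map (fun p : (ι → X) × X => Function.update p.1 i₀ p.2)
        ((Measure.pi fun _ : ι => μ₀).prod μ₀) = Measure.pi fun _ : ι => μ₀ := by
  symm
  refine Measure.pi_eq fun s hs => ?_
  rw [Measure.map_apply measurable_update' (MeasurableSet.univ_pi hs),
    update_preimage_univ_pi_prod, Measure.prod_prod, Measure.pi_pi]
  have happ : (fun j => μ₀ (Function.update s i₀ Set.univ j)) =
      Function.update (fun j => μ₀ (s j)) i₀ (μ₀ Set.univ) := by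
    funext j
    exact Function.apply_update (fun _ t => μ₀ t) s i₀ Set.univ j
  rw [happ, Finset.prod_update_of_mem (Finset.mem_univ i₀), measure_univ, one_mul,
    Finset.prod_eq_prod_sdiff_singleton_mul (Finset.mem_univ i₀) fun j => μ₀ (s j)]

/-- **Resampling one coordinate**: for an integrable `F` on the finite product of copies of a
probability measure `μ₀`, `∫ F = ∫ (∫ F(U[i₀ ↦ g]) dμ₀(g)) dμ₀^{⊗ι}(U)`. -/
theorem integral_pi_eq_integral_update (μ₀ : Measure X) [IsProbabilityMeasure μ₀] (i₀ : ι)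
    {F : (ι → X) → ℝ} (hF : Integrable F (Measure.pi fun _ : ι => μ₀)) :
    ∫ U, F U ∂(Measure.pi fun _ : ι => μ₀) =
      ∫ U, (∫ g, F (Function.update U i₀ g) ∂μ₀) ∂(Measure.pi fun _ : ι => μ₀) := by
  have hΦ : AEMeasurable (fun p : (ι → X) × X => Function.update p.1 i₀ p.2)
      ((Measure.pi fun _ : ι => μ₀).prod μ₀) := measurable_update'.aemeasurable
  have hFm : AEStronglyMeasurable F (Measure.map (fun p : (ι → X) × X => Function.update p.1 i₀ p.2)
      ((Measure.pi fun _ : ι => μ₀).prod μ₀)) := by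
    rw [map_update_pi_prod]; exact hF.aestronglyMeasurable
  have hI : Integrable (fun p : (ι → X) × X => F (Function.update p.1 i₀ p.2))
      ((Measure.pi fun _ : ι => μ₀).prod μ₀) := by
    have h := (integrable_map_measure hFm hΦ).1 (by rw [map_update_pi_prod]; exact hF)
    exact h
  calc ∫ U, F U ∂(Measure.pi fun _ : ι => μ₀)
      = ∫ U, F U ∂(Measure.map (fun p : (ι → X) × X => Function.update p.1 i₀ p.2)
          ((Measure.pi fun _ : ι => μ₀).prod μ₀)) := by rw [map_update_pi_prod]
    _ = ∫ p, F (Function.update p.1 i₀ p.2) ∂((Measure.pi fun _ : ι => μ₀).prod μ₀) :=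
          integral_map hΦ hFm
    _ = ∫ U, (∫ g, F (Function.update U i₀ g) ∂μ₀) ∂(Measure.pi fun _ : ι => μ₀) :=
          integral_prod _ hI

end Resample

section Averaging

variable {ι G : Type*} [Fintype ι] [DecidableEq ι] [Group G] [MeasurableSpace G]
  [MeasurableMul₂ G]

/-- **One private coordinate kills a centred factor**: if `h U` and `Ψ U` do not depend on the
coordinate `i₀`, `μ₀` is a right-invariant probability and `f` is bounded measurable, then
`∫ (f (U i₀ * h U) - ∫ f dμ₀) Ψ U dμ₀^{⊗ι} = 0`. -/
theorem integral_centred_private_eq_zero (μ₀ : Measure G) [IsProbabilityMeasure μ₀]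
    [μ₀.IsMulRightInvariant] (i₀ : ι) {f : G → ℝ} (hf : Measurable f) {Cf : ℝ}
    (hfb : ∀ g, |f g| ≤ Cf) {h : (ι → G) → G} (hh : ∀ U g, h (Function.update U i₀ g) = h U)
    (hhm : Measurable h) {Ψ : (ι → G) → ℝ} (hΨ : ∀ U g, Ψ (Function.update U i₀ g) = Ψ U)
    (hΨm : Measurable Ψ) {CΨ : ℝ} (hΨb : ∀ U, |Ψ U| ≤ CΨ) :
    ∫ U, (f (U i₀ * h U) - ∫ g, f g ∂μ₀) * Ψ U ∂(Measure.pi fun _ : ι => μ₀) = 0 := by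
  have hFm : Measurable fun U : ι → G => (f (U i₀ * h U) - ∫ g, f g ∂μ₀) * Ψ U :=
    ((hf.comp ((measurable_pi_apply i₀).mul hhm)).sub measurable_const).mul hΨm
  have hCf : 0 ≤ Cf := (abs_nonneg _).trans (hfb 1)
  have hFi : Integrable (fun U : ι → G => (f (U i₀ * h U) - ∫ g, f g ∂μ₀) * Ψ U)
      (Measure.pi fun _ : ι => μ₀) := by
    refine Integrable.of_bound hFm.aestronglyMeasurable ((Cf + |∫ g, f g ∂μ₀|) * CΨ)
      (ae_of_all _ fun U => ?_)
    rw [Real.norm_eq_abs, abs_mul]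
    have h1 : |f (U i₀ * h U) - ∫ g, f g ∂μ₀| ≤ Cf + |∫ g, f g ∂μ₀| :=
      (abs_sub _ _).trans (add_le_add (hfb _) le_rfl)
    exact mul_le_mul h1 (hΨb U) (abs_nonneg _) (by positivity)
  rw [integral_pi_eq_integral_update μ₀ i₀ hFi]
  refine integral_eq_zero_of_ae (ae_of_all _ fun U => ?_)
  simp only [Function.update_self, hh, hΨ, Pi.zero_apply]
  have hfi : Integrable (fun g => f (g * h U)) μ₀ :=
    Integrable.of_bound (hf.comp (measurable_id.mul_const _)).aestronglyMeasurable Cf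
      (ae_of_all _ fun g => by rw [Real.norm_eq_abs]; exact hfb _)
  have hint : ∫ g, (f (g * h U) - ∫ g, f g ∂μ₀) * Ψ U ∂μ₀ =
      ((∫ g, f (g * h U) ∂μ₀) - ∫ g, f g ∂μ₀) * Ψ U := by
    rw [integral_mul_const, integral_sub hfi (integrable_const _), integral_const, probReal_univ,
      one_smul]
  rw [hint, integral_mul_right_eq_self f (h U), sub_self, zero_mul]

end Averaging



section TorusMinimal

variable {S : ℕ} [NeZero S]

/-- Pigeonhole per coordinate: fewer than `S` sites miss some residue class in each coordinate. -/
theorem exists_missing_residue (B : Finset (Fin 4 → ℤ)) (hcard : B.card < S) (i : Fin 4) :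
    ∃ c : ZMod S, ∀ y ∈ B, ((y i : ℤ) : ZMod S) ≠ c := by
  by_contra h
  push Not at h
  have hsub : (Finset.univ : Finset (ZMod S)) ⊆ B.image fun y => ((y i : ℤ) : ZMod S) := by
    intro c _
    obtain ⟨y, hy, hyc⟩ := h c
    exact Finset.mem_image.2 ⟨y, hy, hyc⟩
  have h1 : S ≤ (B.image fun y => ((y i : ℤ) : ZMod S)).card := by
    simpa [ZMod.card] using Finset.card_le_card hsub
  have h2 := Finset.card_image_le (s := B) (f := fun y => ((y i : ℤ) : ZMod S))
  omega

/-- The height of a residue above the class following the missing class `c`. -/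
def hgt (c : ZMod S) (z : ZMod S) : ℕ := (z - c - 1).val

omit [NeZero S] in
/-- Heights are `< S`. -/
theorem hgt_lt [NeZero S] (c z : ZMod S) : hgt c z < S := ZMod.val_lt _

/-- A residue different from the missing class has height `≤ S - 2`. -/
theorem hgt_le_of_ne {c z : ZMod S} (hz : z ≠ c) : hgt c z ≤ S - 2 := by
  have hlt := hgt_lt c z
  have hne : hgt c z ≠ S - 1 := by
    intro h
    apply hz
    have h' : (z - c - 1 : ZMod S) = ((S - 1 : ℕ) : ZMod S) := by
      rw [← h]; exact (ZMod.natCast_zmod_val _).symm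
    have hS : ((S - 1 : ℕ) : ZMod S) = -1 := by
      have h1 : 1 ≤ S := Nat.one_le_iff_ne_zero.2 (NeZero.ne S)
      rw [Nat.cast_sub h1, Nat.cast_one, ZMod.natCast_self, zero_sub]
    rw [hS] at h'
    linear_combination h'
  omega

omit [NeZero S] in
/-- Below the top, the height of `z + 1` is the height of `z` plus one (no wrap). -/
theorem hgt_add_one [NeZero S] {c z : ZMod S} (hz : hgt c z ≤ S - 2) (hS : 2 ≤ S) :
    hgt c (z + 1) = hgt c z + 1 := by
  unfold hgt at *
  have h1 : (1 : ZMod S).val = 1 := ZMod.val_one'' (by omega)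
  rw [show z + 1 - c - 1 = (z - c - 1) + 1 by ring, ZMod.val_add_of_lt, h1]
  rw [h1]; omega

/-- Total height of a site w.r.t. the missing classes `c`. -/
def totalHgt (c : Fin 4 → ZMod S) (y : Fin 4 → ℤ) : ℕ := ∑ i, hgt (c i) ((y i : ℤ) : ZMod S)

/-- **A torus-minimal base point.** Among fewer than `S` sites of `ℤ⁴` there is one, `y₀`, that no
other site of the family (nor `y₀` itself) touches FROM BELOW on the torus `(ℤ/S)⁴`: if
`y₀ ≡ y' + ε (mod S)` with `ε ∈ {0,1}⁴` and `y'` in the family, then `ε = 0`. -/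
theorem exists_torusMinimal (B : Finset (Fin 4 → ℤ)) (hB : B.Nonempty) (hcard : B.card < S) :
    ∃ y₀ ∈ B, ∀ y' ∈ B, ∀ ε : Fin 4 → ℤ, (∀ i, ε i = 0 ∨ ε i = 1) →
      Torus.proj S y₀ = Torus.proj S (y' + ε) → ε = 0 := by
  classical
  have hS2 : 2 ≤ S := by
    have := hB.card_pos; omega
  choose c hc using fun i => exists_missing_residue B hcard i
  obtain ⟨y₀, hy₀, hmin⟩ := B.exists_min_image (totalHgt c) hB
  refine ⟨y₀, hy₀, fun y' hy' ε hε hproj => ?_⟩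
  -- heights of `y' + ε` coordinatewise
  have hcoord : ∀ i, hgt (c i) (((y' + ε) i : ℤ) : ZMod S) = hgt (c i) ((y' i : ℤ) : ZMod S) +
      (ε i).toNat := by
    intro i
    have hle : hgt (c i) ((y' i : ℤ) : ZMod S) ≤ S - 2 := hgt_le_of_ne (hc i y' hy')
    rcases hε i with h0 | h1
    · simp [h0]
    · rw [Pi.add_apply, h1, Int.cast_add, Int.cast_one, hgt_add_one hle hS2]
      simp
  have hy₀eq : ∀ i, ((y₀ i : ℤ) : ZMod S) = (((y' + ε) i : ℤ) : ZMod S) := fun i => by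
    have := congrFun hproj i
    simpa [Torus.proj] using this
  have hsum : totalHgt c y₀ = totalHgt c y' + ∑ i, (ε i).toNat := by
    unfold totalHgt
    rw [← Finset.sum_add_distrib]
    exact Finset.sum_congr rfl fun i _ => by rw [hy₀eq i, hcoord i]
  have hle := hmin y' hy'
  have hzero : ∑ i, (ε i).toNat = 0 := by omega
  have hall := (Finset.sum_eq_zero_iff_of_nonneg fun i _ => Nat.zero_le _).1 hzero
  funext i
  rcases hε i with h0 | h1
  · exact h0
  · have := hall i (Finset.mem_univ i)
    rw [h1] at this
    simp at this

/-- `Torus.proj (2L+1)` is injective on the box `[-L, L]⁴`. -/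
theorem proj_injOn_box (L : ℕ) {y y' : Fin 4 → ℤ} (hy : y ∈ box 4 L) (hy' : y' ∈ box 4 L)
    (h : Torus.proj (2 * L + 1) y = Torus.proj (2 * L + 1) y') : y = y' := by
  rw [Literature.Probability.LatticeModels.mem_box] at hy hy'
  funext i
  have hi : ((y i : ℤ) : ZMod (2 * L + 1)) = ((y' i : ℤ) : ZMod (2 * L + 1)) := by
    have := congrFun h i
    simpa [Torus.proj] using this
  have hdvd := (ZMod.intCast_eq_intCast_iff_dvd_sub _ _ _).1 hi
  obtain ⟨lo, hi1⟩ := hy i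
  obtain ⟨lo', hi'⟩ := hy' i
  have hlt : |y' i - y i| < ((2 * L + 1 : ℕ) : ℤ) := by
    rw [abs_lt]; push_cast; constructor <;> omega
  have h0 := Int.eq_zero_of_abs_lt_dvd hdvd hlt
  omega

end TorusMinimal


/-! ## Stage 3: torus plaquettes at `ℤ⁴` base points; the private edge -/

section TorusAlgebra

variable {G : Type} [Group G] [MeasurableSpace G] {N : ℕ}

omit [MeasurableSpace G] in
/-- Plaquette holonomies of the periodic lift are the torus holonomies below
(as in the TunedSequenceExists disprover's work file). -/
theorem plaquetteHolonomyZd_torusLift' {S : ℕ} (U : GaugeConfig 4 S G) (y : Fin 4 → ℤ) (i j : Fin 4) :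
    plaquetteHolonomyZd (torusLift S U) y i j = plaquetteHolonomy U (Torus.proj S y) i j := by
  simp only [plaquetteHolonomyZd, plaquetteHolonomy, torusLift, torusEdge, Function.comp_apply,
    Literature.MathematicalPhysics.QuantumFieldTheory.Site.shift, torusProj_add_single, Int.cast_one]

/-- The torus plaquette observable of the translated periodic lift at base point `x`. -/
theorem plaquetteObs_configShift_torusLift {S : ℕ} (ρ : G →* Matrix (Fin N) (Fin N) ℂ)
    (x : Fin 4 → ℤ) (a b : Fin 4) (U : GaugeConfig 4 S G) :
    plaquetteObs ρ 0 a b (configShift (-x) (torusLift S U)) =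
      (ρ (plaquetteHolonomy U (Torus.proj S x) a b)).trace.re := by
  simp only [plaquetteObs]
  have h : plaquetteHolonomyZd (configShift (-x) (torusLift S U)) 0 a b =
      plaquetteHolonomyZd (torusLift S U) x a b := by
    simp only [plaquetteHolonomyZd, configShift_apply, sub_neg_eq_add, zero_add,
      add_comm (Pi.single _ _) x]
  rw [h, plaquetteHolonomyZd_torusLift']

/-- `proj` commutes with the unit shifts. -/
theorem proj_add_single {S : ℕ} (y : Fin 4 → ℤ) (a : Fin 4) :
    Literature.MathematicalPhysics.QuantumFieldTheory.Site.shift (Torus.proj S y) a =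
      Torus.proj S (y + Pi.single a 1) := by
  rw [torusProj_add_single]
  simp [Literature.MathematicalPhysics.QuantumFieldTheory.Site.shift]

/-- The unit vector `e_a` has entries in `{0, 1}`. -/
theorem single_zero_or_one (a l : Fin 4) :
    (Pi.single a (1 : ℤ) : Fin 4 → ℤ) l = 0 ∨ (Pi.single a (1 : ℤ) : Fin 4 → ℤ) l = 1 := by
  by_cases h : l = a
  · subst h; simp
  · simp [Pi.single_eq_of_ne h]

/-- The zero vector has entries in `{0, 1}`. -/
theorem zero_zero_or_one (l : Fin 4) : (0 : Fin 4 → ℤ) l = 0 ∨ (0 : Fin 4 → ℤ) l = 1 :=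
  Or.inl rfl

/-- `e_a ≠ 0`. -/
theorem single_ne_zero' (a : Fin 4) : (Pi.single a (1 : ℤ) : Fin 4 → ℤ) ≠ 0 := by
  intro h; have := congrFun h a; simp at this

omit [MeasurableSpace G] in
/-- If none of the four edges of the torus plaquette `(p, a', b')` is `E₀`, updating `E₀` does
not change its holonomy. -/
theorem plaquetteHolonomy_update_of_ne {S : ℕ} (U : GaugeConfig 4 S G) (E₀ : Edge 4 S) (g : G)
    (p : Literature.MathematicalPhysics.QuantumFieldTheory.Site 4 S) (a' b' : Fin 4)
    (h1 : (p, a') ≠ E₀)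
    (h2 : (Literature.MathematicalPhysics.QuantumFieldTheory.Site.shift p a', b') ≠ E₀)
    (h3 : (Literature.MathematicalPhysics.QuantumFieldTheory.Site.shift p b', a') ≠ E₀)
    (h4 : (p, b') ≠ E₀) :
    plaquetteHolonomy (Function.update U E₀ g) p a' b' = plaquetteHolonomy U p a' b' := by
  simp only [plaquetteHolonomy, Function.update_of_ne h1, Function.update_of_ne h2,
    Function.update_of_ne h3, Function.update_of_ne h4]

/-- **The private edge.** For base points `x i` (`i ∈ A`), injective mod `S` on `A`, with
`A.card < S`, there is `i₀ ∈ A` such that no base point of the family touches `x i₀` FROM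
BELOW on the torus: `proj (x i₀) = proj (x i + ε)` with `ε ∈ {0,1}⁴`, `i ∈ A` forces `ε = 0` and
`i = i₀`. -/
theorem exists_private_index {S : ℕ} [NeZero S] {n : ℕ} (x : Fin n → Fin 4 → ℤ) (A : Finset (Fin n))
    (hA : A.Nonempty) (hinj : ∀ i ∈ A, ∀ j ∈ A, Torus.proj S (x i) = Torus.proj S (x j) → i = j)
    (hcard : A.card < S) :
    ∃ i₀ ∈ A, ∀ ε : Fin 4 → ℤ, (∀ l, ε l = 0 ∨ ε l = 1) → ∀ i ∈ A,
      Torus.proj S (x i₀) = Torus.proj S (x i + ε) → ε = 0 ∧ i = i₀ := by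
  classical
  have hcard' : (A.image x).card < S := (Finset.card_image_le).trans_lt hcard
  obtain ⟨y₀, hy₀, hmin⟩ := exists_torusMinimal (A.image x) (hA.image x) hcard'
  obtain ⟨i₀, hi₀, rfl⟩ := Finset.mem_image.1 hy₀
  refine ⟨i₀, hi₀, fun ε hε i hi hproj => ?_⟩
  have hε0 : ε = 0 := hmin (x i) (Finset.mem_image_of_mem x hi) ε hε hproj
  subst hε0
  rw [add_zero] at hproj
  exact ⟨rfl, hinj i hi i₀ hi₀ hproj.symm⟩

end TorusAlgebra

/-! ## Stage 4: the centred moments vanish; the `β = 0` moment formula -/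

section BetaZeroMoments

variable {G : Type} [Group G] [TopologicalSpace G] [IsTopologicalGroup G] [CompactSpace G]
  [MeasurableSpace G] [BorelSpace G] {N : ℕ}

/-- The Haar average `d₀ = ∫ Re tr ρ`. -/
def haarTraceRe (ρ : G →* Matrix (Fin N) (Fin N) ℂ) : ℝ := ∫ g, (ρ g).trace.re ∂haarProbability G

/-- The CENTRED torus plaquette observable at the `ℤ⁴` base point `x`, plane `(a, b)`. -/
def cobs {S : ℕ} (ρ : G →* Matrix (Fin N) (Fin N) ℂ) (x : Fin 4 → ℤ) (a b : Fin 4)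
    (U : GaugeConfig 4 S G) : ℝ :=
  (ρ (plaquetteHolonomy U (Torus.proj S x) a b)).trace.re - haarTraceRe ρ

/-- The centred plaquette observables are continuous. -/
theorem continuous_cobs {S : ℕ} (ρ : G →* Matrix (Fin N) (Fin N) ℂ) (hρ : Continuous ρ)
    (x : Fin 4 → ℤ) (a b : Fin 4) : Continuous (cobs (S := S) ρ x a b) := by
  unfold cobs plaquetteHolonomy
  refine Continuous.sub ?_ continuous_const
  exact (continuous_trace_re ρ hρ).comp (by fun_prop)

/-- A uniform bound on the centred plaquette observables. -/
theorem exists_bound_cobs (ρ : G →* Matrix (Fin N) (Fin N) ℂ) (hρ : Continuous ρ) :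
    ∃ C : ℝ, 0 ≤ C ∧ ∀ (S : ℕ) (x : Fin 4 → ℤ) (a b : Fin 4) (U : GaugeConfig 4 S G),
      |cobs ρ x a b U| ≤ C := by
  obtain ⟨B, hB0, hB⟩ := exists_bound_trace_re_nonneg ρ hρ
  refine ⟨B + |haarTraceRe ρ|, by positivity, fun S x a b U => ?_⟩
  unfold cobs
  exact (abs_sub _ _).trans (add_le_add (hB _) le_rfl)

/-- **Vanishing of the centred moments** at `β = 0`: for base points injective mod `S` on a
non-empty index set `A` with `A.card < S` and planes `(a i, b i)` with `a i ≠ b i`,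
`∫ ∏_{i ∈ A} cobs ρ (x i) (a i) (b i) dHaar^{⊗ edges} = 0` — the private edge of the
torus-minimal plaquette is integrated out first and its factor averages to zero by right
invariance of Haar. -/
theorem integral_prod_cobs_eq_zero [SecondCountableTopology G] {S : ℕ} [NeZero S]
    (ρ : G →* Matrix (Fin N) (Fin N) ℂ) (hρ : Continuous ρ) {n : ℕ} (x : Fin n → Fin 4 → ℤ)
    (a b : Fin n → Fin 4) (hab : ∀ i, a i ≠ b i) (A : Finset (Fin n)) (hA : A.Nonempty)
    (hinj : ∀ i ∈ A, ∀ j ∈ A, Torus.proj S (x i) = Torus.proj S (x j) → i = j)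
    (hcard : A.card < S) :
    ∫ U, ∏ i ∈ A, cobs ρ (x i) (a i) (b i) U
      ∂(Measure.pi fun _ : Edge 4 S => haarProbability G) = 0 := by
  classical
  obtain ⟨i₀, hi₀, hpriv⟩ := exists_private_index x A hA hinj hcard
  obtain ⟨C, hC0, hC⟩ := exists_bound_cobs ρ hρ
  obtain ⟨B, hB0, hB⟩ := exists_bound_trace_re_nonneg ρ hρ
  set p₀ := Torus.proj S (x i₀) with hp₀
  set E₀ : Edge 4 S := (p₀, a i₀) with hE₀
  -- which edges can be `E₀`: only the first edge of the own plaquette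
  have hedge : ∀ i ∈ A, ∀ ε : Fin 4 → ℤ, (∀ l, ε l = 0 ∨ ε l = 1) → ∀ c : Fin 4,
      ((Torus.proj S (x i + ε), c) : Edge 4 S) = E₀ → ε = 0 ∧ i = i₀ ∧ c = a i₀ := by
    intro i hi ε hε c heq
    rw [hE₀, Prod.mk.injEq] at heq
    obtain ⟨h0, hii⟩ := hpriv ε hε i hi heq.1.symm
    exact ⟨h0, hii, heq.2⟩
  have hbase : ∀ i, Torus.proj S (x i) = Torus.proj S (x i + 0) := fun i => by rw [add_zero]
  -- holonomies of the other plaquettes do not see `E₀`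
  have hother : ∀ i ∈ A, i ≠ i₀ → ∀ (U : GaugeConfig 4 S G) (g : G),
      cobs ρ (x i) (a i) (b i) (Function.update U E₀ g) = cobs ρ (x i) (a i) (b i) U := by
    intro i hi hne U g
    unfold cobs
    rw [plaquetteHolonomy_update_of_ne]
    · rw [hbase i]; intro heq
      exact hne (hedge i hi 0 zero_zero_or_one _ heq).2.1
    · rw [proj_add_single]; intro heq
      exact single_ne_zero' _ (hedge i hi _ (single_zero_or_one _) _ heq).1
    · rw [proj_add_single]; intro heq
      exact single_ne_zero' _ (hedge i hi _ (single_zero_or_one _) _ heq).1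
    · rw [hbase i]; intro heq
      exact hne (hedge i hi 0 zero_zero_or_one _ heq).2.1
  -- the own holonomy is `U E₀ * M U` with `M` blind to `E₀`
  set M : GaugeConfig 4 S G → G := fun U =>
    U (Literature.MathematicalPhysics.QuantumFieldTheory.Site.shift p₀ (a i₀), b i₀) *
      (U (Literature.MathematicalPhysics.QuantumFieldTheory.Site.shift p₀ (b i₀), a i₀))⁻¹ *
        (U (p₀, b i₀))⁻¹ with hM
  have hhol : ∀ U : GaugeConfig 4 S G, plaquetteHolonomy U p₀ (a i₀) (b i₀) = U E₀ * M U := by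
    intro U; simp only [plaquetteHolonomy, hM, hE₀, mul_assoc]
  have hne2 : (Literature.MathematicalPhysics.QuantumFieldTheory.Site.shift p₀ (a i₀), b i₀) ≠ E₀ := by
    rw [hp₀, proj_add_single]; intro heq
    exact hab i₀ (hedge i₀ hi₀ _ (single_zero_or_one _) _ heq).2.2.symm
  have hne3 : (Literature.MathematicalPhysics.QuantumFieldTheory.Site.shift p₀ (b i₀), a i₀) ≠ E₀ := by
    rw [hp₀, proj_add_single]; intro heq
    exact single_ne_zero' _ (hedge i₀ hi₀ _ (single_zero_or_one _) _ heq).1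
  have hne4 : ((p₀, b i₀) : Edge 4 S) ≠ E₀ := by
    rw [hp₀, hbase i₀]; intro heq
    exact hab i₀ (hedge i₀ hi₀ 0 zero_zero_or_one _ heq).2.2.symm
  have hM_upd : ∀ U g, M (Function.update U E₀ g) = M U := by
    intro U g
    simp only [hM, Function.update_of_ne hne2, Function.update_of_ne hne3, Function.update_of_ne hne4]
  -- measurability
  have hcoord : ∀ e : Edge 4 S, Measurable fun U : GaugeConfig 4 S G => U e := fun e =>
    measurable_pi_apply e
  have hmeasM : Measurable M := by
    simp only [hM]
    exact ((hcoord _).mul (hcoord _).inv).mul (hcoord _).inv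
  have hmeas_cobs : ∀ i, Measurable (cobs (S := S) ρ (x i) (a i) (b i)) := fun i =>
    (continuous_cobs ρ hρ (x i) (a i) (b i)).measurable
  -- split off the `i₀` factor
  set Ψ : GaugeConfig 4 S G → ℝ := fun U => ∏ i ∈ A.erase i₀, cobs ρ (x i) (a i) (b i) U with hΨ
  have hsplit : ∀ U : GaugeConfig 4 S G, ∏ i ∈ A, cobs ρ (x i) (a i) (b i) U =
      ((fun g : G => (ρ g).trace.re) (U E₀ * M U) - ∫ g, (ρ g).trace.re ∂haarProbability G) * Ψ U := by
    intro U
    rw [← Finset.mul_prod_erase A _ hi₀]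
    congr 1
    show cobs ρ (x i₀) (a i₀) (b i₀) U = _
    unfold cobs haarTraceRe
    rw [← hp₀, hhol U]
  simp_rw [hsplit]
  refine integral_centred_private_eq_zero (haarProbability G) E₀ (f := fun g : G => (ρ g).trace.re)
    ((continuous_trace_re ρ hρ).measurable) (Cf := B) hB (h := M) hM_upd hmeasM (Ψ := Ψ) ?_ ?_
    (CΨ := C ^ (A.erase i₀).card) ?_
  · intro U g
    simp only [hΨ]
    refine Finset.prod_congr rfl fun i hi => ?_
    exact hother i (Finset.mem_of_mem_erase hi) (Finset.ne_of_mem_erase hi) U g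
  · simp only [hΨ]
    exact Finset.measurable_prod _ fun i _ => hmeas_cobs i
  · intro U
    simp only [hΨ]
    rw [Finset.abs_prod]
    calc ∏ i ∈ A.erase i₀, |cobs ρ (x i) (a i) (b i) U| ≤ ∏ _i ∈ A.erase i₀, C :=
          Finset.prod_le_prod (fun i _ => abs_nonneg _) fun i _ => hC _ _ _ _ _
      _ = C ^ (A.erase i₀).card := Finset.prod_const C

end BetaZeroMoments

/-! ## Stage 4b: the `β = 0` moment formula -/

section MomentFormula

variable {G : Type} [Group G] [TopologicalSpace G] [IsTopologicalGroup G] [CompactSpace G]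
  [MeasurableSpace G] [BorelSpace G] {N : ℕ}

omit [TopologicalSpace G] [IsTopologicalGroup G] [CompactSpace G] [MeasurableSpace G] [BorelSpace G] in
/-- The action density as a sum over the six planes `a < b`. -/
theorem actionDensity_eq_sum_planes (ρ : G →* Matrix (Fin N) (Fin N) ℂ) (V : LGConfig 4 G) :
    actionDensity ρ V = ∑ q : {p : Fin 4 × Fin 4 // p.1 < p.2}, plaquetteObs ρ 0 q.1.1 q.1.2 V := by
  unfold actionDensity
  rw [← Finset.sum_product', Finset.univ_product_univ, ← Finset.sum_filter]
  exact Finset.sum_subtype _ (fun x => by simp) (fun x : Fin 4 × Fin 4 => plaquetteObs ρ 0 x.1 x.2 V)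

/-- There are six coordinate planes. -/
theorem card_planes : Fintype.card {p : Fin 4 × Fin 4 // p.1 < p.2} = 6 := by decide

/-- **The `β = 0` moment formula.** For `n < S` base points that are pairwise distinct on the
torus of side `S`, under product Haar,
`∫ ∏ᵢ (actionDensity at xᵢ − m) = (6 d₀ − m)ⁿ`, `d₀ = ∫ Re tr ρ dHaar`: the product of the
translated action densities integrates like a product of CONSTANTS. -/
theorem integral_prod_actionDensity_sub [SecondCountableTopology G] {S : ℕ} [NeZero S]
    (ρ : G →* Matrix (Fin N) (Fin N) ℂ) (hρ : Continuous ρ) {n : ℕ} (x : Fin n → Fin 4 → ℤ)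
    (hinj : Function.Injective fun i => Torus.proj S (x i)) (hn : n < S) (m : ℝ) :
    ∫ U, ∏ i, (actionDensity ρ (configShift (-(x i)) (torusLift S U)) - m)
        ∂(Measure.pi fun _ : Edge 4 S => haarProbability G) = (6 * haarTraceRe ρ - m) ^ n := by
  classical
  set K : ℝ := 6 * haarTraceRe ρ - m with hK
  set μ : Measure (GaugeConfig 4 S G) := Measure.pi fun _ : Edge 4 S => haarProbability G with hμ
  -- the Option encoding of "constant or a centred plane factor"
  let term : Fin n → Option {p : Fin 4 × Fin 4 // p.1 < p.2} → GaugeConfig 4 S G → ℝ :=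
    fun i o U => o.elim K fun q => cobs ρ (x i) q.1.1 q.1.2 U
  have hfac : ∀ (i : Fin n) (U : GaugeConfig 4 S G),
      actionDensity ρ (configShift (-(x i)) (torusLift S U)) - m = ∑ o, term i o U := by
    intro i U
    rw [Fintype.sum_option, actionDensity_eq_sum_planes]
    simp only [term, Option.elim, plaquetteObs_configShift_torusLift, cobs]
    rw [Finset.sum_sub_distrib, Finset.sum_const, Finset.card_univ, card_planes, hK]
    ring
  simp_rw [hfac, Fintype.prod_sum]
  -- bounds and measurability of the terms
  obtain ⟨C, hC0, hC⟩ := exists_bound_cobs ρ hρ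
  have hterm_bd : ∀ i o (U : GaugeConfig 4 S G), |term i o U| ≤ max |K| C := by
    intro i o U; cases o with
    | none => exact le_max_left _ _
    | some q => exact (hC S (x i) q.1.1 q.1.2 U).trans (le_max_right _ _)
  have hterm_meas : ∀ i o, Measurable (term i o) := by
    intro i o; cases o with
    | none => exact measurable_const
    | some q => exact (continuous_cobs ρ hρ (x i) q.1.1 q.1.2).measurable
  have hint : ∀ χ : Fin n → Option {p : Fin 4 × Fin 4 // p.1 < p.2},
      Integrable (fun U => ∏ i, term i (χ i) U) μ := by
    intro χ
    refine Integrable.of_bound (Finset.measurable_prod _ fun i _ => hterm_meas i (χ i)).aestronglyMeasurable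
      ((max |K| C) ^ n) (ae_of_all _ fun U => ?_)
    rw [Real.norm_eq_abs, Finset.abs_prod]
    calc ∏ i, |term i (χ i) U| ≤ ∏ _i : Fin n, max |K| C :=
          Finset.prod_le_prod (fun i _ => abs_nonneg _) fun i _ => hterm_bd i (χ i) U
      _ = (max |K| C) ^ n := by rw [Finset.prod_const, Finset.card_univ, Fintype.card_fin]
  rw [integral_finsetSum _ fun χ _ => hint χ]
  -- only the all-constant term survives
  rw [Finset.sum_eq_single (fun _ => none)]
  · simp only [term, Option.elim, Finset.prod_const, Finset.card_univ, Fintype.card_fin,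
      integral_const, hμ, probReal_univ, smul_eq_mul, one_mul]
  · intro χ _ hχ
    -- a genuine centred factor is present
    have hex : ∃ i, χ i ≠ none := by
      by_contra hall
      push Not at hall
      exact hχ (funext hall)
    set A : Finset (Fin n) := Finset.univ.filter fun i => χ i ≠ none with hA
    have hAne : A.Nonempty := by
      obtain ⟨i, hi⟩ := hex
      exact ⟨i, Finset.mem_filter.2 ⟨Finset.mem_univ _, hi⟩⟩
    let a' : Fin n → Fin 4 := fun i => (χ i).elim 0 fun q => q.1.1
    let b' : Fin n → Fin 4 := fun i => (χ i).elim 1 fun q => q.1.2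
    have hab : ∀ i, a' i ≠ b' i := by
      intro i; simp only [a', b']
      cases h : χ i with
      | none => simp
      | some q => simpa using q.2.ne
    have hsplit : ∀ U : GaugeConfig 4 S G, ∏ i, term i (χ i) U =
        K ^ (Finset.univ.filter fun i => χ i = none).card * ∏ i ∈ A, cobs ρ (x i) (a' i) (b' i) U := by
      intro U
      rw [← Finset.prod_filter_mul_prod_filter_not Finset.univ (fun i => χ i = none)]
      congr 1
      · rw [← Finset.prod_const K]
        refine Finset.prod_congr rfl fun i hi => ?_
        rw [(Finset.mem_filter.1 hi).2]
        rfl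
      · refine Finset.prod_congr rfl fun i hi => ?_
        have hne := (Finset.mem_filter.1 hi).2
        obtain ⟨q, hq⟩ := Option.ne_none_iff_exists'.1 hne
        simp only [term, a', b', hq, Option.elim]
    simp_rw [hsplit]
    rw [integral_const_mul, integral_prod_cobs_eq_zero ρ hρ x a' b' hab A hAne
      (fun i _ j _ h => hinj h) ((Finset.card_filter_le _ _).trans_lt (by simpa using hn)), mul_zero]
  · intro h; exact absurd (Finset.mem_univ _) h

end MomentFormula

/-! ## Stage 5: the lattice `n`-point functions of the curvature at `β = 0` -/

section LatticeSchwingerBetaZero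

variable {G : Type} [Group G] [TopologicalSpace G] [IsTopologicalGroup G] [CompactSpace G]
  [MeasurableSpace G] [BorelSpace G]

open scoped SchwartzMap

omit [Group G] [TopologicalSpace G] [IsTopologicalGroup G] [CompactSpace G] [BorelSpace G] in
/-- The periodic lift is measurable. -/
theorem measurable_torusLift'' (S : ℕ) : Measurable (torusLift (d := 4) (G := G) S) :=
  measurable_pi_lambda _ fun _ => measurable_pi_apply _

/-- **`latticeSchwinger` at `β = 0` — EXACT formula.** For a scheme step `k` with `β_k = 0`,
`n < side_k`, any lattice representation `r` and real test functions `f i` whose tensor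
product vanishes at every non-injective family of box sites (e.g. an off-diagonal real tensor),
the lattice `n`-point function of the curvature string is the `n`-point function of the
CONSTANT field `κ_k = c_k (6 d₀ − m_k)`:
`⟨∏ᵢ Φ(fᵢ)⟩_k = κ_kⁿ ∏ᵢ a_k⁴ Σ_{y ∈ box} fᵢ(a_k y)`. -/
theorem latticeSchwinger_beta_zero (r : LatticeRep G) (sch : SpeciesScheme (YMSpecies G)) (k : ℕ)
    (hβ : sch.β k = 0) {n : ℕ} (hn : n < sch.side k) (f : Fin n → 𝓢(EuclideanSpace ℝ (Fin 4), ℝ))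
    (hf : ∀ Y : Fin n → Fin 4 → ℤ, (∀ i, Y i ∈ box 4 (sch.L k)) → ¬ Function.Injective Y →
      ∏ i, f i (sch.a k • siteToE (Y i)) = 0) :
    latticeSchwinger r.ρ sch (fun s => s.F) k n (fun _ => r.curvature) f =
      (sch.c r.curvature k * (6 * haarTraceRe r.ρ - sch.m r.curvature k)) ^ n *
        ∏ i, (sch.a k ^ 4 * ∑ y ∈ box 4 (sch.L k), f i (sch.a k • siteToE y)) := by
  classical
  haveI : SecondCountableTopology G :=
    (r.continuous.isClosedEmbedding r.injective).isEmbedding.secondCountableTopology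
  have hcurv : r.curvature.F = actionDensity r.ρ := rfl
  unfold latticeSchwinger
  dsimp only
  rw [hβ, Theorems.LatticeGapOnTrajectory.Negative.wilsonMeasure_zero_coupling]
  simp only [hcurv, smearedLatticeField]
  -- Step 1: pull the constants `c a⁴` out of the product and expand the product of sums
  have hstep1 : ∀ U : GaugeConfig 4 (sch.side k) G,
      (∏ i, sch.c r.curvature k * sch.a k ^ 4 * ∑ y ∈ box 4 (sch.L k), f i (sch.a k • siteToE y) *
        (actionDensity r.ρ (configShift (-y) (torusLift (sch.side k) U)) - sch.m r.curvature k)) =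
      (sch.c r.curvature k * sch.a k ^ 4) ^ n *
        ∑ Y ∈ Fintype.piFinset (fun _ : Fin n => box 4 (sch.L k)),
          (∏ i, f i (sch.a k • siteToE (Y i))) *
            ∏ i, (actionDensity r.ρ (configShift (-(Y i)) (torusLift (sch.side k) U)) -
              sch.m r.curvature k) := by
    intro U
    rw [Finset.prod_mul_distrib, Finset.prod_const, Finset.card_univ, Fintype.card_fin,
      Finset.prod_univ_sum]
    congr 1
    refine Finset.sum_congr rfl fun Y _ => ?_
    rw [← Finset.prod_mul_distrib]
  simp_rw [hstep1]
  -- integrability of each summand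
  obtain ⟨CA, hCA⟩ := r.curvature.bounded
  have hmeasAD : ∀ y : Fin 4 → ℤ, Measurable fun U : GaugeConfig 4 (sch.side k) G =>
      actionDensity r.ρ (configShift (-y) (torusLift (sch.side k) U)) := fun y =>
    r.curvature.measurable.comp ((configShift (-y)).measurable.comp (measurable_torusLift'' _))
  have hint : ∀ Y : Fin n → Fin 4 → ℤ, Integrable (fun U : GaugeConfig 4 (sch.side k) G =>
      (∏ i, f i (sch.a k • siteToE (Y i))) *
        ∏ i, (actionDensity r.ρ (configShift (-(Y i)) (torusLift (sch.side k) U)) -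
          sch.m r.curvature k)) (Measure.pi fun _ : Edge 4 (sch.side k) => haarProbability G) := by
    intro Y
    refine Integrable.const_mul ?_ _
    refine Integrable.of_bound (Finset.measurable_prod _ fun i _ =>
      (hmeasAD (Y i)).sub measurable_const).aestronglyMeasurable ((CA + |sch.m r.curvature k|) ^ n)
      (ae_of_all _ fun U => ?_)
    rw [Real.norm_eq_abs, Finset.abs_prod]
    calc ∏ i, |actionDensity r.ρ (configShift (-(Y i)) (torusLift (sch.side k) U)) - sch.m r.curvature k|
        ≤ ∏ _i : Fin n, (CA + |sch.m r.curvature k|) :=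
          Finset.prod_le_prod (fun i _ => abs_nonneg _) fun i _ =>
            (abs_sub _ _).trans (add_le_add (hCA _) le_rfl)
      _ = (CA + |sch.m r.curvature k|) ^ n := by
          rw [Finset.prod_const, Finset.card_univ, Fintype.card_fin]
  rw [integral_const_mul, integral_finsetSum _ fun Y _ => hint Y]
  -- Step 2: each summand integrates to `(∏ f) * Kⁿ`
  have hstep2 : ∀ Y ∈ Fintype.piFinset (fun _ : Fin n => box 4 (sch.L k)),
      ∫ U, (∏ i, f i (sch.a k • siteToE (Y i))) *
          ∏ i, (actionDensity r.ρ (configShift (-(Y i)) (torusLift (sch.side k) U)) -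
            sch.m r.curvature k) ∂(Measure.pi fun _ : Edge 4 (sch.side k) => haarProbability G) =
        (∏ i, f i (sch.a k • siteToE (Y i))) * (6 * haarTraceRe r.ρ - sch.m r.curvature k) ^ n := by
    intro Y hY
    have hYbox : ∀ i, Y i ∈ box 4 (sch.L k) := fun i => Fintype.mem_piFinset.1 hY i
    rw [integral_const_mul]
    by_cases hYinj : Function.Injective Y
    · congr 1
      refine integral_prod_actionDensity_sub r.ρ r.continuous Y (fun i j hij => hYinj ?_) hn _
      exact proj_injOn_box (sch.L k) (hYbox i) (hYbox j) hij
    · rw [hf Y hYbox hYinj, zero_mul, zero_mul]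
  rw [Finset.sum_congr rfl hstep2, ← Finset.sum_mul]
  have h2 := Finset.prod_univ_sum (fun _ : Fin n => box 4 (sch.L k))
    (fun i y => f i (sch.a k • siteToE y))
  rw [← h2]
  -- Step 3: algebra
  rw [Finset.prod_mul_distrib, Finset.prod_const, Finset.card_univ, Fintype.card_fin, mul_pow,
    mul_pow]
  ring

end LatticeSchwingerBetaZero


/-! ## Stage 6: consequences for the crux — a family tied to a `β ≡ 0` scheme is a c-number field -/

section TieBetaZero

variable {G : Type} [Group G] [TopologicalSpace G] [IsTopologicalGroup G] [CompactSpace G]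
  [MeasurableSpace G] [BorelSpace G]

open scoped SchwartzMap

omit [Group G] [TopologicalSpace G] [IsTopologicalGroup G] [CompactSpace G] [MeasurableSpace G]
  [BorelSpace G] in
/-- The half-sides of a species scheme tend to infinity (`a_k → 0`, `a_k L_k → ∞`). -/
theorem tendsto_L_atTop {ι : Type} (sch : SpeciesScheme ι) :
    Tendsto (fun k => (sch.L k : ℝ)) atTop atTop := by
  have ha : ∀ᶠ k in atTop, sch.a k ≤ 1 := sch.tendsto_a.eventually (eventually_le_nhds one_pos)
  refine tendsto_atTop_mono' atTop ?_ sch.tendsto_L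
  filter_upwards [ha] with k hk
  have hL : (0 : ℝ) ≤ sch.L k := Nat.cast_nonneg _
  calc sch.a k * sch.L k ≤ 1 * sch.L k := by gcongr
    _ = sch.L k := one_mul _

omit [Group G] [TopologicalSpace G] [IsTopologicalGroup G] [CompactSpace G] [MeasurableSpace G]
  [BorelSpace G] in
/-- Eventually `n < side_k`. -/
theorem eventually_lt_side {ι : Type} (sch : SpeciesScheme ι) (n : ℕ) :
    ∀ᶠ k in atTop, n < sch.side k := by
  have h := (tendsto_L_atTop sch).eventually_ge_atTop (n : ℝ)
  filter_upwards [h] with k hk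
  have hk' : n ≤ sch.L k := by exact_mod_cast hk
  show n < 2 * sch.L k + 1
  omega

/-- An off-diagonal real tensor vanishes at every non-injective family of (rescaled) sites. -/
theorem prod_eq_zero_of_not_injective {n : ℕ} {f : Fin n → 𝓢(EuclideanSpace ℝ (Fin 4), ℝ)}
    {F : 𝓢((Fin n → EuclideanSpace ℝ (Fin 4)), ℂ)} (hF : IsTensorOf F fun i => ofRealTest (f i))
    (hF' : IsOffDiagonal F) (a : ℝ) (Y : Fin n → Fin 4 → ℤ) (hY : ¬ Function.Injective Y) :
    ∏ i, f i (a • siteToE (Y i)) = 0 := by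
  have hmem : (fun i => a • siteToE (Y i)) ∈ coincidenceLocus n (EuclideanSpace ℝ (Fin 4)) := by
    simp only [Function.Injective, not_forall] at hY
    obtain ⟨i, j, hij, hne⟩ := hY
    exact ⟨i, j, hne, by simp [hij]⟩
  have h0 := hF'.apply_eq_zero hmem
  rw [hF] at h0
  simp only [ofRealTest_apply, ← Complex.ofReal_prod, Complex.ofReal_eq_zero] at h0
  exact h0

omit [Group G] [TopologicalSpace G] [IsTopologicalGroup G] [CompactSpace G] [MeasurableSpace G]
  [BorelSpace G] in
/-- In degree `1` every test function is off-diagonal. -/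
theorem isOffDiagonal_fin_one' {E : Type*} [NormedAddCommGroup E] [NormedSpace ℝ E]
    (F : 𝓢((Fin 1 → E), ℂ)) : IsOffDiagonal F := by
  rintro x ⟨i, j, hij, -⟩
  exact absurd (Subsingleton.elim i j) hij

/-- **A family tied to a scheme with `β_k = 0` FREQUENTLY (e.g. `β ≡ 0`) is a C-NUMBER FIELD on
off-diagonal real tensors**:
`S₁ n (f₁ ⊗ ⋯ ⊗ fₙ) = ∏ᵢ S₁ 1 (fᵢ)`, whatever `c_k, m_k, a_k, L_k` and whatever the faithful
representation `r` — so no `β ≡ 0` scheme can ever tie a non-trivial family, and for the crux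
every `β ≡ 0` witness collapses (next theorem). -/
theorem tie_beta_zero_factorises (r : LatticeRep G) (sch : SpeciesScheme (YMSpecies G))
    (hβ : ∃ᶠ k in atTop, sch.β k = 0) {S₁ : SchwingerFamily (EuclideanSpace ℝ (Fin 4))}
    (htie : ∀ (n : ℕ), n ≠ 0 → ∀ (f : Fin n → 𝓢(EuclideanSpace ℝ (Fin 4), ℝ))
      (F : 𝓢((Fin n → EuclideanSpace ℝ (Fin 4)), ℂ)), IsTensorOf F (fun i => ofRealTest (f i)) →
      IsOffDiagonal F → Tendsto (fun k : ℕ => ((latticeSchwinger r.ρ sch (fun s => s.F) k n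
        (fun _ => r.curvature) f : ℝ) : ℂ)) atTop (𝓝 (S₁ n F)))
    {n : ℕ} (hn : n ≠ 0) (f : Fin n → 𝓢(EuclideanSpace ℝ (Fin 4), ℝ))
    (F : 𝓢((Fin n → EuclideanSpace ℝ (Fin 4)), ℂ)) (hF : IsTensorOf F fun i => ofRealTest (f i))
    (hF' : IsOffDiagonal F) (F₁ : Fin n → 𝓢((Fin 1 → EuclideanSpace ℝ (Fin 4)), ℂ))
    (hF₁ : ∀ i, IsTensorOf (F₁ i) fun _ => ofRealTest (f i)) :
    S₁ n F = ∏ i, S₁ 1 (F₁ i) := by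
  have hlimn := htie n hn f F hF hF'
  have hlim1 : ∀ i, Tendsto (fun k : ℕ => ((latticeSchwinger r.ρ sch (fun s => s.F) k 1
      (fun _ => r.curvature) (fun _ => f i) : ℝ) : ℂ)) atTop (𝓝 (S₁ 1 (F₁ i))) := fun i =>
    htie 1 one_ne_zero (fun _ => f i) (F₁ i) (hF₁ i) (isOffDiagonal_fin_one' _)
  have hprod := tendsto_finsetProd Finset.univ fun i _ => hlim1 i
  refine tendsto_nhds_unique_of_frequently_eq hlimn hprod (hβ.mp ?_)
  filter_upwards [eventually_lt_side sch n, eventually_lt_side sch 1] with k hkn hk1 hβk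
  rw [latticeSchwinger_beta_zero r sch k hβk hkn f
    (fun Y _ hY => prod_eq_zero_of_not_injective hF hF' _ Y hY)]
  simp_rw [latticeSchwinger_beta_zero r sch k hβk hk1 (fun _ => f _)
    (fun Y _ hY => (hY (Function.injective_of_subsingleton Y)).elim)]
  push_cast
  simp only [Finset.univ_unique, Finset.prod_singleton, pow_one]
  simp only [Finset.prod_mul_distrib, Finset.prod_const, Finset.card_univ, Fintype.card_fin, mul_pow]

/-- **No counterexample from ANY scheme with `β_k = 0` frequently** (arbitrary `c_k, m_k, a_k, L_k`,
any `r`; so a counterexample needs `β_k ≠ 0` for ALL large `k`):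
the conclusion of the crux on off-diagonal real tensors — for EVERY linear isometry `R`, not
only the planar rotations — reduces to the invariance of the ONE-POINT distribution `S₁ 1`,
which `W₁` already makes translation invariant (hence, on paper, `κ · dx`, invariant under
every isometry). -/
theorem apply_linActMulti_eq_of_beta_zero (r : LatticeRep G) (sch : SpeciesScheme (YMSpecies G))
    (hβ : ∃ᶠ k in atTop, sch.β k = 0) {S₁ : SchwingerFamily (EuclideanSpace ℝ (Fin 4))}
    (htie : ∀ (n : ℕ), n ≠ 0 → ∀ (f : Fin n → 𝓢(EuclideanSpace ℝ (Fin 4), ℝ))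
      (F : 𝓢((Fin n → EuclideanSpace ℝ (Fin 4)), ℂ)), IsTensorOf F (fun i => ofRealTest (f i)) →
      IsOffDiagonal F → Tendsto (fun k : ℕ => ((latticeSchwinger r.ρ sch (fun s => s.F) k n
        (fun _ => r.curvature) f : ℝ) : ℂ)) atTop (𝓝 (S₁ n F)))
    (R : EuclideanSpace ℝ (Fin 4) ≃ₗᵢ[ℝ] EuclideanSpace ℝ (Fin 4))
    (h1 : ∀ (g : 𝓢(EuclideanSpace ℝ (Fin 4), ℝ)) (G₁ : 𝓢((Fin 1 → EuclideanSpace ℝ (Fin 4)), ℂ)),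
      IsTensorOf G₁ (fun _ => ofRealTest g) → S₁ 1 (linActMulti R G₁) = S₁ 1 G₁)
    {n : ℕ} (hn : n ≠ 0) (f : Fin n → 𝓢(EuclideanSpace ℝ (Fin 4), ℝ))
    (F : 𝓢((Fin n → EuclideanSpace ℝ (Fin 4)), ℂ)) (hF : IsTensorOf F fun i => ofRealTest (f i))
    (hF' : IsOffDiagonal F) : S₁ n (linActMulti R F) = S₁ n F := by
  choose F₁ hF₁ using fun i => exists_isTensorOf (fun _ : Fin 1 => ofRealTest (f i))
  rw [tie_beta_zero_factorises r sch hβ htie hn f F hF hF' F₁ hF₁,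
    tie_beta_zero_factorises r sch hβ htie hn (fun i => linActTest R (f i)) (linActMulti R F)
      (hF.linActMulti R) (isOffDiagonal_linActMulti hF' R) (fun i => linActMulti R (F₁ i))
      (fun i => (hF₁ i).linActMulti R)]
  exact Finset.prod_congr rfl fun i _ => h1 (f i) (F₁ i) (hF₁ i)

end TieBetaZero


/-! ## §5 Attack ledger (documentation) -/

/-- **§5. REGIMES TRIED AND WHY EACH RESISTS** (the constant `True`; read the docstring).

1. `c ≡ 0` (zero scheme and relatives): §2 — tied family vanishes on ⁰𝒮-tensors. Holds.
2. `β ≡ 0`, arbitrary `c_k, m_k, a_k, L_k`, any faithful `ρ` (possibly reducible): with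
   `P₀ = ∫_G ρ dHaar` (projection on invariants, `d₀ = tr P₀`), `E[Re tr ρ(U_p) | other links] = d₀`
   exactly (left invariance), and among pairwise distinct plaquettes on a torus of side `> n + 2`
   the lexicographically extreme one has a private link; hence for pairwise DISTINCT sites
   `E ∏ᵢ (O_{xᵢ} - m) = (6 d₀ - m)ⁿ`.  Off-diagonal real tensors have `fᵢ fⱼ ≡ 0` (flat-disjoint
   supports), so only distinct sites enter and
   `latticeSchwinger_k = (c_k (6d₀ - m_k))ⁿ ∏ᵢ a_k⁴ Σ_{x∈box} fᵢ(a_k x)` EXACTLY; the tie at `n = 1`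
   forces `c_k(6d₀ - m_k) → κ`, so `S₁ = κⁿ ∏∫fᵢ` on ⁰𝒮-tensors: a c-number field, invariant under
   every isometry.  (Lean: §6 of this file.)  Holds.
3. `β_k` eventually in the Osterwalder–Seiler region `|β| < β₁/4` (tree `StrongCoupling*`,
   `osterwalder_seiler_torusClustering_holds`): truncated plaquette correlations decay like
   `e^{-μ(β)·dist}` in lattice units, i.e. `e^{-μ δ/a_k}` at physical separation `δ`; on a
   flat-touching pair `f = e^{-ε/x₀^s}…, g` the truncated 2-point sum is `≍ e^{-C ε^{1/(s+1)}
   a_k^{-s/(s+1)}}` — arbitrarily slow stretched exponentials as `s ↓ 0` — so the tie forces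
   `log c_k = o(a_k^{-δ})` for every `δ > 0` OR divergence; in the first case every truncated
   contribution dies on ⁰𝒮-tensors and `S₁` is again the c-number field.  (Paper; a Lean proof
   needs n-point OS78 clustering with constants AND lower bounds on truncated correlations.) Holds.
4. Fixed `β` outside that region / `β_k → ∞`: no control (crossover/asymptotic scaling) — this
   is where an anisotropic limit would have to live; constructing one is the open problem.
5. Group degeneracies: `IsCompactSimpleLieGroup` forces a genuine connected non-abelian compact
   Lie group with a faithful unitary `ρ`; reducible `ρ` with trivial summands only shifts `d₀`.
6. Junk for the MODEL-BLIND core (all dead, see §1b docstring): classical mixtures, finite-order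
   truncations, coordinate-sheet-supported two-point functions.
7. Hypothesis mutation: dropping E2/E4/E0'/gaps/cone/8 frames does NOT make the crux cheaply
   refutable either — the tie alone already forces the conclusion in every controlled regime
   (items 1–3).  So no clause other than the tie is "load-bearing" in the refuter's sense; their
   role is only inside the intended proof.  Dropping the tie: FALSE (§1b).  Dropping
   `IsOffDiagonal` in the conclusion: FALSE (§4). -/
theorem regimes_tried : True := trivial

/-! ## §7 Pre-assessment of the round-1 first-lemma stubs (targets-to-be) -/

/-- **§7. STUBS OF THE THREE CRUX CARDS, refuter's pre-assessment** (no line picked yet, so no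
`-- Targets`; recorded for the triage panel and the lead; the constant `True`).

* `BoostInheritedMirrorSieve.OddTopHarmonicVanishes` (card boosts-inherit-mirrors,
  `BoostsInheritMirrorsSketch.lean`): TRUE and elementary as typed — from the pencil hypothesis
  at `H_f = θf̄ ⊗ f`: `Re Σ_{|m|≤|M|} sᵐ C(4m) H_f ≥ 0` for all real `s ≠ 0` and `M` odd forces
  `Re C(±4M) H_f = 0` (let `s → ±∞`, `s → 0±`: odd powers change sign), the `Im = 0` clause gives
  `Im C(4m) H_f = 0` for every `m`; polarisation over `f + g`, `f + ig` (time-ordered one-point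
  functions form a complex subspace; `C k` is additive in the witness `H`) gives
  `C(±4M)(θf̄ ⊗ g) = 0`.  The hypotheses "4M is the top harmonic" and "θ ↦ S 2 (rot θ · F)
  continuous" are NOT used — decoration (tell the lead).  Negative `M`: vacuous-true.
* `BoostInheritedMirrorSieve.TwoPointSieve`: plausible (model-blind n = 2 theorem with the UV
  softening `t_j⁸ K(t_j e₀) → 0` as hypothesis); consistent with every witness of §1b/§5 (they have
  UV degree 10 and violate the softening, as the card says).  Not cheaply attackable; its cap step
  needs `|K(R_{θ+iχ}ξ)| ≤ K((Re ζ − |Im β|)e₀)`, valid because RP + cone make `K(te₀)` the Laplace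
  transform of a positive measure supported in `E ≥ |p₁|`.
* `AnisotropyCostsADimension.coshFour_pincer` (card anisotropy-costs-a-dimension): TRUE, two lines
  (`a + b y ≥ 0` and `a − b y ≥ 0` for all `y ≥ 1` ⇒ `|b| y ≤ a` for all `y` ⇒ `b = 0`).
* `OneFieldCocyclePinning.periodic_zeroFree_rigidity` (card one-field-cocycle-pinning): TRUE as
  typed (`h = e^g`; periodicity ⇒ `g(z + iπ/2) − g(z) = 2πik₀`; `Re g ≤ log C + N|Re z|` +
  periodicity ⇒ `Re g ≤ A + N|z|` ⇒ Borel–Carathéodory ⇒ `g` affine ⇒ slope `4k₀`); degenerate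
  parameter values (`C ≤ 0`, `N < 0`) are vacuous or give `k = 0`.  Lean cost: Borel–Carathéodory /
  "entire with `Re g = O(|z|)` is affine" is not in Mathlib.
* `AnisotropyCostsADimension.CurvatureUVDegree` / `HasTwoPointUVDegreeLtTen` (statement stubs):
  not refutable by any controlled scheme (§5: c-number limits have UV degree `≤ 8`); they are the
  honest YM-specific input.

Verdict for the lead: none of the round-1 first lemmas is false; two carry unused hypotheses. -/
theorem stubs_preassessed : True := trivial

end Summit.QuantumFields.YangMills.Cruxes.CurvatureBoostCovariance.Disproof

end
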